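import Summits.KontsevichZagierPeriods.KontsevichZagierPeriods.Theses.SymplecticScissors
import Literature.NumberTheory.Transcendental.KZCalculusProofs
import Literature.NumberTheory.Transcendental.KZSubcalculusInvariants

/-!
# Disproof work file for the crux `SymplecticScissors.PlanarK0Injective` (stmt-KontsevichZagierPeriods-9847)

Standing adversary (refuter `cdisprove`; gen 1 = cycle 1/1b, gen 2 = cycle 2, gen 3 = cycle 3, 2026-08-16).
Everything below is sorry-free (`lean check` rc 0).

THE CRUX. `PlanarK0Injective`: two planar sets `r r' : KZ.IntegralRep 2` (ℚ-semialgebraic, integrand `1`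
on the domain, finite area) with `r.value = r'.value` satisfy
`[r] − [r'] ∈ planarGroup := closure((domainAddRel ∪ changeOfVariablesRel) ∩ closure planarGens)` —
curved scissors (1a) and ℚ-semialgebraic area-preserving injections (2) among PLANAR SETS only.

VERDICT SO FAR (end of cycle 3): **no kill**; the statement is a faithful encoding of an open problem
(curved Bolyai–Gerwien over ℚ̄ in group form, strictly above Conjecture 1 on the sector), and every
cheap or structural attack listed below is CONSISTENT with it. What is proved here:

* §0 `Kit` — rational boxes as planar sets (`boxRep`, `closedBoxRep`, values), the free-group pinning
  lemma `eq_of_of_sub_of_eq` (`of a − of b = of c − of d`, `a ≠ b` ⇒ `a = c ∧ b = d`), the two unit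
  squares, `not_isCompact_openUnitSquare`.  [landed: Negative/Kit.lean, p72882]
* §1 JUNK IMMUNITY: null planar sets are `0` in `planarGroup` (`of_mem_planarGroup_of_volume_eq_zero`,
  the `N = N ∪ N` instance of 1a) and two planar sets with the same domain are congruent by the
  identity move whatever their off-domain integrands (`of_sub_of_mem_planarGroup_of_domain_eq`). So every
  candidate invariant must factor through the Lebesgue class of the domain.  [Kit.lean]
* §2 LOAD-BEARING HYPOTHESES as theorems: `planarK0Injective_false_without_value_eq` (unit square vs
  `(0,2)×(0,1)`; soundness) and `planarK0Injective_false_without_integrand_one` (`[(0,1)², 2]` vs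
  `(0,2)×(0,1)`; the additive `planarDefect : FormalRep →+ ℤ`).  [landed: Negative/LoadBearing.lean, p74261]
* §3 TIGHTNESS OF THE MOVE SET / refuted natural strengthenings: `not_planarOneMove` (ONE rule-2 move
  does not relate `[0,1]²` to `(0,1)²`: compactness; so rule 1a is load-bearing and the Monge form MUST
  discard null sets), `not_planarScissorsOnly` (rule 1a alone cannot translate: the window invariant
  `KZ.restrictedEval`; so rule 2 is load-bearing), §3b `not_planarOneMoveOpen` (one move can fail even
  between OPEN sets of equal area: preconnectedness).  [landed: Negative/OneMove.lean p74086, LoadBearing.lean]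
* §5 CALIBRATION `diag(2, ½)`: `[(0,1)²] − [(0,2)×(0,½)]` is ONE move (aspect ratio is no invariant).
* §6 (cycle 2) THE DEHN FORM: `planarK0Injective_iff_forall_invariant` — the crux holds iff EVERY additive
  invariant `FormalRep →+ A` vanishing on the planar moves takes equal values on equal-area planar sets
  (← via the quotient `FormalRep ⧸ planarGroup`). A refutation is a curved Dehn invariant and nothing else.
* §7 (cycle 2) ORIENTATION IS NOT LOAD-BEARING: the chiral pair `{0<y<x²}` / `{0<y<(1−x)²}` over `(0,1)`
  is ONE move with `det DΦ = +1` (`Φ(x,y) = (1−x, x²−y)`, rotation by π + shear;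
  `parabola_mirror_mem_orientedChangeOfVariablesRel`, with `orientedChangeOfVariablesRel` ⊆ rule 2). On paper
  the same trick orients every mirror image of a subgraph cell, so chirality is no invariant and the `|·|`
  in `|det| = 1` is never needed between planar sets (information for provers: WLOG oriented chains).
* §8 (cycle 2) BOUNDEDNESS IS NOT A ONE-MOVE INVARIANT: the unbounded horn `{x>1, 0<y<1/x²}` is ONE move
  from `(0,1)²` (`Φ(x,y) = (1/x, x²y)`, `det = −1`; `horn_sub_openUnitSquare_mem_changeOfVariablesRel`,
  `not_isBounded_hornSet`, `volume_hornSet` by Mathlib's Jacobian formula) — contrast §3 (compactness,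
  preconnectedness ARE one-move invariants).
* §9 (cycle 2) POSITIVE BOUNDARY OF §3: `boxRep_sub_boxRep_mem_changeOfVariablesRel` — ANY two rational
  open boxes of equal area are ONE move apart (`p ↦ l' + diag(s₀,s₁)(p − l)`, `s₀s₁ = 1` forced by the
  areas); `PlanarOneMove` fails only through boundary/topology, never through shape or position.
* §4 (docstring `whyItResists`, extended in cycle 2 by `whyItResists2`) — the obstruction analysis.
* §10 (cycle 3) TAMENESS IS LOAD-BEARING IN REVERSE: the semicubical cusp cell `{0<x<1, 0<y, y²<x³}` is
  congruent to the box `(0,1)×(0,2/5)` by TWO rational non-tame moves (`(t²,y/(2t))` blows the origin up into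
  the cusp; `(t⁵,y/(5t⁴))` flattens the quartic cell `{0<y<2t⁴}`) — `cusp_sub_cuspBox_mem_planarGroup`; whereas
  in every TAME sub-calculus (maps `C²` across the boundary of the piece: Richter 2002, Cresson–Viu-Sos's `K₀`)
  the half-branch parity `μ` separates them (paper theorem in `whyItResists3` (2)).  [proposed: Negative/CuspBlowUp.lean,
  Negative/CuspFlatten.lean]
* §11 (cycle 3) THE GROUP ONLY SEES LEBESGUE CLASSES: cutting along any ℚ-semialgebraic set inside `planarGroup`,
  discarding null parts, and `of_sub_of_mem_planarGroup_of_ae_eq` (a.e.-equal planar sets are congruent), hence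
  `invariant_eq_of_ae_eq`.  [proposed: Negative/AeClass.lean]
* §12 (cycle 3) `whyItResists3`: the literature sweep (Richter 2002 = DHK continued: essential arcs, Thm 2(a),
  equiaffine Cor. 2, the `κ`-parity `μ`; CVS 2022 §2.2 is a TAME `K₀`), the tame/non-tame dichotomy, the hierarchy
  of sub-pseudogroups with their Dehn invariants, and why every local invariant is dead for KZ's rule 2.

Dead ends for the next disprover (one line each; cycle 3 adds: boundary-arc / corner / half-branch / Puiseux
invariants à la DHK–Richter are dead — essentiality fails by shears + dilations, tameness fails by boundary
blow-ups, §10/§12; the tame sub-calculus IS refutable but is not the crux): value-level counterexamples are impossible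
(`r.value = r'.value` + soundness); off-domain integrand junk and null sets give nothing (§1);
topological invariants of the domain give nothing (cut along curves + discard null sets); unboundedness
and cusps are removed by explicit |det| = 1 semialgebraic maps (§8, `(x,y) ↦ (x³/3, y/x²)`); chirality /
orientation gives nothing (§7); shape and position of boxes give nothing even at chain length one (§5, §9);
TORSION gives nothing (cycle 2, paper: `M := closure planarGens ⧸ planarGroup` is uniquely divisible —
`T_λ = diag(1, λ)`-conjugation acts on moves for algebraic `λ > 0`, `[T_{m+n}D] = [T_mD] + [T_nD]` by
stacking, so `n·x = 0 ⇒ T_n x ∈ planarGroup ⇒ x = T_{1/n}T_n x ∈ planarGroup`); the dimension-1 analogue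
is trivially TRUE (|Φ′| = 1 forces algebraic translations; equal-length finite unions of algebraic
intervals are equidecomposable by greedy cutting), so the content starts at n = 2; the real-coefficient
analogue is false but not expressible here (domains are ℚ-semialgebraic by type); relaxing rule 2 to
NON-semialgebraic C¹ area-preserving injections makes the statement true for soft reasons (Moser /
Greene–Shiohama on area-matched cells, areas matched exactly by piecewise-linear semialgebraic transport with
slack — paper, §4) so the ENTIRE content is the ℚ̄-Nash constraint on the maps; restricting rule 2 to
AFFINE unimodular maps makes it FALSE (paper, §4: the signed equi-affine arc length `∮ κ^{1/3} ds` of the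
curved part of the essential boundary is additive under curved cuts and equi-affine invariant; `0` for the
unit square, `≠ 0` for `{0<x<1, 0<y<3x²}`), so genuinely non-affine Nash maps are load-bearing. A genuine
kill needs an additive invariant of Lebesgue classes of planar ℚ-regions under piecewise-Nash symplectic
injections that is finer than area — equivalently (§6) a Huber–Wüstholz relation among real curve-type
1-periods with no planar realisation; none is known (CressonViusos2022 Problem 2.1 / Rem 2.3 pose exactly
this and give no invariant), and the acid test (γ) of §4 (Fermat-ninth / Gauss triplication) is motivically
CONSISTENT (cycle 2: both Beta values live on simple CM factors of `J(F₉)` of the same CM type `{2,4,8}`,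
hence isogenous, and an isogeny defined over a REAL number field exists by Hilbert 90 — see `whyItResists2`).
-/

noncomputable section

open MeasureTheory Set MvPolynomial
open Literature.NumberTheory.Transcendental Literature.ModelTheory.ExponentialFields

namespace Summit.KontsevichZagierPeriods.KontsevichZagierPeriods.Cruxes.PlanarK0Injective.Disproof

open Summit.KontsevichZagierPeriods.KontsevichZagierPeriods.Theses.SymplecticScissors (PlanarK0Injective)

/-! ## §0 Kit: the planar set-chain group, rational boxes, free-group pinning -/

/-- The generators of the planar sector: `[s]` for `s : IntegralRep 2` with integrand `1` on its
domain ("planar sets"); verbatim the inner set of the crux. [folklore] -/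
def planarGens : Set KZ.FormalRep :=
  {x | ∃ s : KZ.IntegralRep 2, (∀ p ∈ s.domain, s.integrand p = 1) ∧ x = KZ.of s}

/-- The planar set-chain group of the crux: the subgroup generated by the instances of rules (1a)
and (2) that are ℤ-combinations of planar sets; verbatim the subgroup of the crux. [folklore] -/
def planarGroup : AddSubgroup KZ.FormalRep :=
  AddSubgroup.closure ((KZ.domainAddRel ∪ KZ.changeOfVariablesRel) ∩
    (AddSubgroup.closure planarGens : Set KZ.FormalRep))

/-- The crux, restated through `planarGroup` (definitional). [folklore] -/
theorem planarK0Injective_iff :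
    PlanarK0Injective ↔ ∀ r r' : KZ.IntegralRep 2, (∀ p ∈ r.domain, r.integrand p = 1) →
      (∀ p ∈ r'.domain, r'.integrand p = 1) → r.value = r'.value →
      KZ.of r - KZ.of r' ∈ planarGroup := Iff.rfl

/-- The planar set-chain group lies in `KZ.relations` (this is the support `GroupToAreas`). [folklore] -/
theorem planarGroup_le_relations : planarGroup ≤ KZ.relations :=
  (AddSubgroup.closure_le _).mpr fun _ hc => hc.1.elim (fun h => KZ.domainAddRel_subset_relations h)
    (fun h => KZ.changeOfVariablesRel_subset_relations h)

/-- Soundness of the planar set-chain group: its elements evaluate to `0`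
(`KZ.relations_le_ker_eval_holds`). [folklore] -/
theorem eval_eq_zero_of_mem_planarGroup {c : KZ.FormalRep} (hc : c ∈ planarGroup) : KZ.eval c = 0 := by
  have h : KZ.relations ≤ KZ.eval.ker := KZ.relations_le_ker_eval_holds
  exact AddMonoidHom.mem_ker.mp (h (planarGroup_le_relations hc))

/-- Open coordinate box `∏ᵢ (lᵢ, uᵢ)` in the plane. [folklore] -/
def box (l u : Fin 2 → ℝ) : Set (Fin 2 → ℝ) := Set.pi univ fun i => Ioo (l i) (u i)

/-- Membership in a box. [folklore] -/
theorem mem_box {l u : Fin 2 → ℝ} {p : Fin 2 → ℝ} : p ∈ box l u ↔ ∀ i, l i < p i ∧ p i < u i := by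
  simp [box]

/-- Coordinate slabs `{lo < pᵢ < hi}` with rational ends are ℚ-semialgebraic. [folklore] -/
theorem isSemialgebraic_coord_Ioo (i : Fin 2) (l u : ℚ) :
    IsSemialgebraic ℚ {p : Fin 2 → ℝ | p i ∈ Ioo (l : ℝ) u} := by
  have h := (isSemialgebraic_setOf_eval_lt (k := ℚ) (R := ℝ) (ι := Fin 2) (C l) (X i)).inter
    (isSemialgebraic_setOf_eval_lt (k := ℚ) (R := ℝ) (ι := Fin 2) (X i) (C u))
  have hEq : {p : Fin 2 → ℝ | p i ∈ Ioo (l : ℝ) u} =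
      {x : Fin 2 → ℝ | aeval x (C l : MvPolynomial (Fin 2) ℚ) < aeval x (X i : MvPolynomial (Fin 2) ℚ)} ∩
      {x : Fin 2 → ℝ | aeval x (X i : MvPolynomial (Fin 2) ℚ) < aeval x (C u : MvPolynomial (Fin 2) ℚ)} := by
    ext p; simp
  rw [hEq]; exact h

/-- Closed coordinate slabs `{lo ≤ pᵢ ≤ hi}` with rational ends are ℚ-semialgebraic. [folklore] -/
theorem isSemialgebraic_coord_Icc (i : Fin 2) (l u : ℚ) :
    IsSemialgebraic ℚ {p : Fin 2 → ℝ | p i ∈ Icc (l : ℝ) u} := by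
  have h := (isSemialgebraic_setOf_eval_le (k := ℚ) (R := ℝ) (ι := Fin 2) (C l) (X i)).inter
    (isSemialgebraic_setOf_eval_le (k := ℚ) (R := ℝ) (ι := Fin 2) (X i) (C u))
  have hEq : {p : Fin 2 → ℝ | p i ∈ Icc (l : ℝ) u} =
      {x : Fin 2 → ℝ | aeval x (C l : MvPolynomial (Fin 2) ℚ) ≤ aeval x (X i : MvPolynomial (Fin 2) ℚ)} ∩
      {x : Fin 2 → ℝ | aeval x (X i : MvPolynomial (Fin 2) ℚ) ≤ aeval x (C u : MvPolynomial (Fin 2) ℚ)} := by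
    ext p; simp
  rw [hEq]; exact h

/-- A box is the intersection of its coordinate slabs. [folklore] -/
theorem box_eq_iInter (l u : Fin 2 → ℝ) :
    box l u = ⋂ i ∈ (Finset.univ : Finset (Fin 2)), {p : Fin 2 → ℝ | p i ∈ Ioo (l i) (u i)} := by
  ext p; simp [box]

/-- Open boxes with rational corners are ℚ-semialgebraic. [folklore] -/
theorem isSemialgebraic_box (l u : Fin 2 → ℚ) :
    IsSemialgebraic ℚ (box (fun i => (l i : ℝ)) (fun i => (u i : ℝ))) := by
  rw [box_eq_iInter]
  exact IsSemialgebraic.biInter _ _ fun i _ => isSemialgebraic_coord_Ioo i (l i) (u i)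

/-- A closed box is the intersection of its closed coordinate slabs. [folklore] -/
theorem Icc_eq_iInter (l u : Fin 2 → ℝ) :
    Icc l u = ⋂ i ∈ (Finset.univ : Finset (Fin 2)), {p : Fin 2 → ℝ | p i ∈ Icc (l i) (u i)} := by
  ext p; simp [Pi.le_def, forall_and]

/-- Closed boxes with rational corners are ℚ-semialgebraic. [folklore] -/
theorem isSemialgebraic_Icc (l u : Fin 2 → ℚ) :
    IsSemialgebraic ℚ (Icc (fun i => (l i : ℝ)) (fun i => (u i : ℝ))) := by
  rw [Icc_eq_iInter]
  exact IsSemialgebraic.biInter _ _ fun i _ => isSemialgebraic_coord_Icc i (l i) (u i)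

/-- The constant function `1` is ℚ-semialgebraic on every ℚ-semialgebraic set. [folklore] -/
theorem isSemialgebraicFunOn_one {s : Set (Fin 2 → ℝ)} (hs : IsSemialgebraic ℚ s) :
    IsSemialgebraicFunOn ℚ s (fun _ => (1 : ℝ)) :=
  (isSemialgebraicFunOn_natCast hs 1).congr fun _ _ => by simp

/-- An open box lies in the closed box. [folklore] -/
theorem box_subset_Icc (l u : Fin 2 → ℝ) : box l u ⊆ Icc l u :=
  (Set.pi_univ_Ioo_subset l u).trans Ioo_subset_Icc_self

/-- Boxes have finite area. [folklore] -/
theorem volume_box_ne_top (l u : Fin 2 → ℝ) : volume (box l u) ≠ ⊤ :=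
  ((measure_mono (box_subset_Icc l u)).trans_lt (isCompact_Icc.measure_lt_top)).ne

/-- The open rational box `∏ (lᵢ, uᵢ)` as a planar set (integrand `1`). [folklore] -/
def boxRep (l u : Fin 2 → ℚ) : KZ.IntegralRep 2 where
  domain := box (fun i => (l i : ℝ)) (fun i => (u i : ℝ))
  integrand := fun _ => 1
  isSemialgebraic_domain := isSemialgebraic_box l u
  isSemialgebraicFunOn_integrand := isSemialgebraicFunOn_one (isSemialgebraic_box l u)
  integrableOn := integrableOn_const (volume_box_ne_top _ _)

/-- The closed rational box `∏ [lᵢ, uᵢ]` as a planar set (integrand `1`). [folklore] -/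
def closedBoxRep (l u : Fin 2 → ℚ) : KZ.IntegralRep 2 where
  domain := Icc (fun i => (l i : ℝ)) (fun i => (u i : ℝ))
  integrand := fun _ => 1
  isSemialgebraic_domain := isSemialgebraic_Icc l u
  isSemialgebraicFunOn_integrand := isSemialgebraicFunOn_one (isSemialgebraic_Icc l u)
  integrableOn := integrableOn_const (isCompact_Icc.measure_lt_top).ne

/-- Unfolding. [folklore] -/
@[simp] theorem boxRep_domain (l u : Fin 2 → ℚ) :
    (boxRep l u).domain = box (fun i => (l i : ℝ)) (fun i => (u i : ℝ)) := rfl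
/-- Unfolding. [folklore] -/
@[simp] theorem boxRep_integrand (l u : Fin 2 → ℚ) : (boxRep l u).integrand = fun _ => 1 := rfl
/-- Unfolding. [folklore] -/
@[simp] theorem closedBoxRep_domain (l u : Fin 2 → ℚ) :
    (closedBoxRep l u).domain = Icc (fun i => (l i : ℝ)) (fun i => (u i : ℝ)) := rfl
/-- Unfolding. [folklore] -/
@[simp] theorem closedBoxRep_integrand (l u : Fin 2 → ℚ) : (closedBoxRep l u).integrand = fun _ => 1 := rfl

/-- The area of an open rational box. [folklore] -/
theorem value_boxRep {l u : Fin 2 → ℚ} (h : ∀ i, l i ≤ u i) :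
    (boxRep l u).value = ((u 0 : ℝ) - l 0) * ((u 1 : ℝ) - l 1) := by
  have hle : (fun i => (l i : ℝ)) ≤ fun i => (u i : ℝ) :=
    fun i => show ((l i : ℚ) : ℝ) ≤ ((u i : ℚ) : ℝ) from by exact_mod_cast h i
  simp only [KZ.IntegralRep.value, boxRep_domain, boxRep_integrand, setIntegral_const, smul_eq_mul,
    mul_one, Measure.real, box]
  rw [Real.volume_pi_Ioo_toReal hle]
  simp [Fin.prod_univ_two]

/-- The area of a closed rational box. [folklore] -/
theorem value_closedBoxRep {l u : Fin 2 → ℚ} (h : ∀ i, l i ≤ u i) :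
    (closedBoxRep l u).value = ((u 0 : ℝ) - l 0) * ((u 1 : ℝ) - l 1) := by
  have hle : (fun i => (l i : ℝ)) ≤ fun i => (u i : ℝ) :=
    fun i => show ((l i : ℚ) : ℝ) ≤ ((u i : ℚ) : ℝ) from by exact_mod_cast h i
  simp only [KZ.IntegralRep.value, closedBoxRep_domain, closedBoxRep_integrand, setIntegral_const,
    smul_eq_mul, mul_one, Measure.real]
  rw [Real.volume_Icc_pi_toReal hle]
  simp [Fin.prod_univ_two]

/-- FREE-GROUP PINNING: in a free abelian group, `of a − of b = of c − of d` with `a ≠ b` forces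
`a = c` and `b = d` (evaluate the counting homomorphisms at `a` and at `b`). This is what pins a
single-move membership `[r] − [r'] ∈ changeOfVariablesRel` to an instance FROM `r` ONTO `r'`. [folklore] -/
theorem eq_of_of_sub_of_eq {X : Type*} {a b c d : X} (hab : a ≠ b)
    (h : FreeAbelianGroup.of a - FreeAbelianGroup.of b =
      FreeAbelianGroup.of c - FreeAbelianGroup.of d) : a = c ∧ b = d := by
  classical
  have key : ∀ x : X, ((if a = x then (1:ℤ) else 0) - (if b = x then 1 else 0)) =
      ((if c = x then 1 else 0) - (if d = x then 1 else 0)) := fun x => by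
    simpa only [map_sub, FreeAbelianGroup.lift_apply_of] using
      congrArg (FreeAbelianGroup.lift fun y => if y = x then (1:ℤ) else 0) h
  have ha := key a
  have hb := key b
  rw [if_pos rfl, if_neg (Ne.symm hab)] at ha
  rw [if_pos rfl, if_neg hab] at hb
  refine ⟨?_, ?_⟩
  · by_contra hca
    rw [if_neg (show ¬ c = a from fun h => hca h.symm)] at ha
    by_cases hda : d = a
    · rw [if_pos hda] at ha; omega
    · rw [if_neg hda] at ha; omega
  · by_contra hdb
    rw [if_neg (show ¬ d = b from fun h => hdb h.symm)] at hb
    by_cases hcb : c = b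
    · rw [if_pos hcb] at hb; omega
    · rw [if_neg hcb] at hb; omega


/-! ### The two unit squares -/

/-- The open unit square `(0,1)²` as a planar set. [folklore] -/
abbrev openUnitSquare : KZ.IntegralRep 2 := boxRep ![0, 0] ![1, 1]

/-- The closed unit square `[0,1]²` as a planar set. [folklore] -/
abbrev closedUnitSquare : KZ.IntegralRep 2 := closedBoxRep ![0, 0] ![1, 1]

/-- Membership in the open unit square. [folklore] -/
theorem mem_openUnitSquare {p : Fin 2 → ℝ} :
    p ∈ openUnitSquare.domain ↔ (0 < p 0 ∧ p 0 < 1) ∧ (0 < p 1 ∧ p 1 < 1) := by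
  simp [mem_box, Fin.forall_fin_two]

/-- Membership in the closed unit square. [folklore] -/
theorem mem_closedUnitSquare {p : Fin 2 → ℝ} :
    p ∈ closedUnitSquare.domain ↔ (0 ≤ p 0 ∧ 0 ≤ p 1) ∧ (p 0 ≤ 1 ∧ p 1 ≤ 1) := by
  simp [Pi.le_def, Fin.forall_fin_two]

/-- The open unit square has area `1`. [folklore] -/
theorem value_openUnitSquare : openUnitSquare.value = 1 := by
  rw [value_boxRep (fun i => by fin_cases i <;> simp)]; simp

/-- The closed unit square has area `1`. [folklore] -/
theorem value_closedUnitSquare : closedUnitSquare.value = 1 := by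
  rw [value_closedBoxRep (fun i => by fin_cases i <;> simp)]; simp

/-- The origin lies in the closed unit square. [folklore] -/
theorem zero_mem_closedUnitSquare : (0 : Fin 2 → ℝ) ∈ closedUnitSquare.domain := by
  rw [mem_closedUnitSquare]; norm_num

/-- The origin does not lie in the open unit square. [folklore] -/
theorem zero_not_mem_openUnitSquare : (0 : Fin 2 → ℝ) ∉ openUnitSquare.domain := by
  rw [mem_openUnitSquare]; norm_num

/-- The two unit squares are different representations. [folklore] -/
theorem openUnitSquare_ne_closedUnitSquare : openUnitSquare ≠ closedUnitSquare := fun h =>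
  zero_not_mem_openUnitSquare (h ▸ zero_mem_closedUnitSquare)

/-- The closed unit square is compact. [folklore] -/
theorem isCompact_closedUnitSquare : IsCompact closedUnitSquare.domain := isCompact_Icc

/-- The open unit square is not compact (the first coordinate has no minimum on it). [folklore] -/
theorem not_isCompact_openUnitSquare : ¬ IsCompact openUnitSquare.domain := by
  intro hK
  have hne : openUnitSquare.domain.Nonempty :=
    ⟨fun _ => 1/2, by rw [mem_openUnitSquare]; norm_num⟩
  obtain ⟨p, hp, hmin⟩ := hK.exists_isMinOn hne (continuous_apply 0).continuousOn
  rw [mem_openUnitSquare] at hp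
  set q : Fin 2 → ℝ := Function.update p 0 (p 0 / 2) with hq_def
  have hq : q ∈ openUnitSquare.domain := by
    rw [mem_openUnitSquare]
    simp only [hq_def, Function.update_self, Function.update_of_ne (show (1 : Fin 2) ≠ 0 by decide)]
    refine ⟨⟨by linarith [hp.1.1], by linarith [hp.1.2]⟩, hp.2⟩
  have hle := (isMinOn_iff.mp hmin) q hq
  simp only [hq_def, Function.update_self] at hle
  linarith [hp.1.1]

/-! ## §1 Positive bookkeeping (formal-junk immunity of the planar set-chain group)

These two lemmas record that the encoding offers a disprover NO foothold through junk: a planar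
set of measure zero is `0` in the group, and two planar sets with the same domain (integrands both
`1` on it, arbitrary off it) are congruent by the identity move. -/

/-- A null planar set is trivial in the planar set-chain group: `[N] − [N] − [N] ∈ domainAddRel`
(`N = N ∪ N`, overlap `N` null), hence `[N] ∈ planarGroup`. [folklore] -/
theorem of_mem_planarGroup_of_volume_eq_zero (s : KZ.IntegralRep 2)
    (hs : ∀ p ∈ s.domain, s.integrand p = 1) (h0 : volume s.domain = 0) :
    KZ.of s ∈ planarGroup := by
  have hgen : KZ.of s ∈ AddSubgroup.closure planarGens := AddSubgroup.subset_closure ⟨s, hs, rfl⟩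
  have h1a : KZ.of s - KZ.of s - KZ.of s ∈ KZ.domainAddRel :=
    ⟨2, s, s, s, (union_self _).symm, by simpa using h0, fun _ _ => rfl, fun _ _ => rfl, rfl⟩
  have hneg : -KZ.of s ∈ planarGroup := by
    refine AddSubgroup.subset_closure ⟨Or.inl ?_, ?_⟩
    · simpa using h1a
    · simpa using (AddSubgroup.closure planarGens).neg_mem hgen
  simpa using planarGroup.neg_mem hneg

/-- Two planar sets with the same domain are congruent by ONE identity move (the integrands agree
with `1` on the domain only; their off-domain values are invisible to the calculus). [folklore] -/
theorem of_sub_of_mem_planarGroup_of_domain_eq (r r' : KZ.IntegralRep 2)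
    (hr : ∀ p ∈ r.domain, r.integrand p = 1) (hr' : ∀ p ∈ r'.domain, r'.integrand p = 1)
    (h : r.domain = r'.domain) : KZ.of r - KZ.of r' ∈ planarGroup := by
  refine AddSubgroup.subset_closure ⟨Or.inr ?_, ?_⟩
  · refine ⟨2, r, r', id, fun _ => ContinuousLinearMap.id ℝ (Fin 2 → ℝ),
      isSemialgebraicMapOn_id r.isSemialgebraic_domain, fun x _ => hasFDerivWithinAt_id x _,
      injOn_id _, by simp [h], fun x hx => ?_, rfl⟩
    simp [hr x hx, hr' x (h ▸ hx), ContinuousLinearMap.det]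
  · exact (AddSubgroup.closure planarGens).sub_mem (AddSubgroup.subset_closure ⟨r, hr, rfl⟩)
      (AddSubgroup.subset_closure ⟨r', hr', rfl⟩)

/-! ## §2 Load-bearing hypotheses -/

/-- The crux with the hypothesis `r.value = r'.value` deleted. [folklore] -/
def PlanarK0InjectiveWithoutValueEq : Prop :=
  ∀ r r' : KZ.IntegralRep 2, (∀ p ∈ r.domain, r.integrand p = 1) →
    (∀ p ∈ r'.domain, r'.integrand p = 1) → KZ.of r - KZ.of r' ∈ planarGroup

/-- **Any proof must use `r.value = r'.value`**: the unit square and the `2 × 1` rectangle are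
planar sets with different areas, and the planar set-chain group is sound
(`eval_eq_zero_of_mem_planarGroup`). Witness: `(0,1)²` versus `(0,2) × (0,1)`. [folklore] -/
theorem planarK0Injective_false_without_value_eq : ¬ PlanarK0InjectiveWithoutValueEq := by
  intro h
  have hmem := h openUnitSquare (boxRep ![0, 0] ![2, 1]) (fun _ _ => rfl) (fun _ _ => rfl)
  have h0 := eval_eq_zero_of_mem_planarGroup hmem
  rw [map_sub, KZ.eval_of, KZ.eval_of, value_openUnitSquare,
    value_boxRep (fun i => by fin_cases i <;> simp)] at h0
  norm_num at h0

/-- The crux with the integrand-`1` hypothesis on `r` deleted (the one on `r'` kept). [folklore] -/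
def PlanarK0InjectiveWithoutIntegrandOne : Prop :=
  ∀ r r' : KZ.IntegralRep 2, (∀ p ∈ r'.domain, r'.integrand p = 1) → r.value = r'.value →
    KZ.of r - KZ.of r' ∈ planarGroup

open Classical in
/-- The planar defect: a generator counts `1` unless it is a planar set (dimension 2, integrand `1`
on its domain). It kills `planarGroup` and detects representations that are not planar sets. [folklore] -/
def planarDefect : KZ.FormalRep →+ ℤ :=
  FreeAbelianGroup.lift fun p => if FreeAbelianGroup.of p ∈ planarGens then 0 else 1

/-- The planar defect kills the subgroup generated by planar sets. [folklore] -/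
theorem closure_planarGens_le_ker_planarDefect :
    AddSubgroup.closure planarGens ≤ planarDefect.ker := by
  refine (AddSubgroup.closure_le _).mpr fun x hx => ?_
  obtain ⟨s, hs, rfl⟩ := hx
  have hmem : FreeAbelianGroup.of (⟨2, s⟩ : Σ n, KZ.IntegralRep n) ∈ planarGens := ⟨s, hs, rfl⟩
  simp [planarDefect, KZ.of, hmem]

/-- The planar set-chain group lies in the subgroup generated by planar sets. [folklore] -/
theorem planarGroup_le_closure_planarGens : planarGroup ≤ AddSubgroup.closure planarGens :=
  (AddSubgroup.closure_le _).mpr fun _ hc => hc.2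

/-- The planar defect kills the planar set-chain group. [folklore] -/
theorem planarDefect_eq_zero_of_mem_planarGroup {c : KZ.FormalRep} (hc : c ∈ planarGroup) :
    planarDefect c = 0 :=
  AddMonoidHom.mem_ker.mp
    (closure_planarGens_le_ker_planarDefect (planarGroup_le_closure_planarGens hc))

/-- The unit square with the constant integrand `2` (value `2`, NOT a planar set). [folklore] -/
def twoSquare : KZ.IntegralRep 2 where
  domain := openUnitSquare.domain
  integrand := fun _ => 2
  isSemialgebraic_domain := openUnitSquare.isSemialgebraic_domain
  isSemialgebraicFunOn_integrand :=
    (isSemialgebraicFunOn_natCast openUnitSquare.isSemialgebraic_domain 2).congr fun _ _ => by simp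
  integrableOn := integrableOn_const (volume_box_ne_top _ _)

/-- `[(0,1)², 2]` has value `2`. [folklore] -/
theorem value_twoSquare : twoSquare.value = 2 := by
  have hle : (fun i => ((![0, 0] : Fin 2 → ℚ) i : ℝ)) ≤ fun i => ((![1, 1] : Fin 2 → ℚ) i : ℝ) :=
    fun i => by fin_cases i <;> simp
  simp only [KZ.IntegralRep.value, twoSquare, boxRep_domain, setIntegral_const, smul_eq_mul,
    Measure.real, box]
  rw [Real.volume_pi_Ioo_toReal hle]
  simp [Fin.prod_univ_two]

/-- `[(0,1)², 2]` is not a planar set (its integrand is `2 ≠ 1` at `(1/2, 1/2)`). [folklore] -/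
theorem of_twoSquare_not_mem_planarGens : KZ.of twoSquare ∉ planarGens := by
  rintro ⟨s, hs, hEq⟩
  have hinj := FreeAbelianGroup.of_injective hEq
  rw [Sigma.mk.inj_iff] at hinj
  obtain ⟨-, hrs⟩ := hinj
  have hrs' : twoSquare = s := eq_of_heq hrs
  have hp : (fun _ => (1:ℝ)/2 : Fin 2 → ℝ) ∈ twoSquare.domain := by
    show _ ∈ openUnitSquare.domain
    rw [mem_openUnitSquare]; norm_num
  have := hs _ (hrs' ▸ hp)
  rw [← hrs'] at this
  norm_num [twoSquare] at this

/-- `[(0,1)², 2]` has planar defect `1`. [folklore] -/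
theorem planarDefect_twoSquare : planarDefect (KZ.of twoSquare) = 1 := by
  simp [planarDefect, KZ.of]
  intro h
  exact (of_twoSquare_not_mem_planarGens h).elim

/-- Planar sets have planar defect `0`. [folklore] -/
theorem planarDefect_of_mem {s : KZ.IntegralRep 2} (hs : ∀ p ∈ s.domain, s.integrand p = 1) :
    planarDefect (KZ.of s) = 0 :=
  AddMonoidHom.mem_ker.mp
    (closure_planarGens_le_ker_planarDefect (AddSubgroup.subset_closure ⟨s, hs, rfl⟩))

/-- **Any proof must use the integrand-`1` hypotheses**: `[(0,1)², 2]` and the planar set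
`(0,2) × (0,1)` have the same value `2`, but their difference has planar defect `1 ≠ 0`, so it is
not even in the subgroup generated by planar sets, let alone in `planarGroup`. [folklore] -/
theorem planarK0Injective_false_without_integrand_one : ¬ PlanarK0InjectiveWithoutIntegrandOne := by
  intro h
  have hmem := h twoSquare (boxRep ![0, 0] ![2, 1]) (fun _ _ => rfl)
    (by rw [value_twoSquare, value_boxRep (fun i => by fin_cases i <;> simp)]; norm_num)
  have h0 := planarDefect_eq_zero_of_mem_planarGroup hmem
  rw [map_sub, planarDefect_twoSquare, planarDefect_of_mem (fun _ _ => rfl)] at h0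
  norm_num at h0

/-! ## §3 Tightness of the move set: neither move alone suffices -/

/-- NATURAL STRENGTHENING I (the Monge form WITHOUT discarding null sets): equal-area planar sets
differ by ONE change-of-variables move. [folklore] -/
def PlanarOneMove : Prop :=
  ∀ r r' : KZ.IntegralRep 2, (∀ p ∈ r.domain, r.integrand p = 1) →
    (∀ p ∈ r'.domain, r'.integrand p = 1) → r.value = r'.value →
    KZ.of r - KZ.of r' ∈ KZ.changeOfVariablesRel

/-- **Refuted strengthening / rule (1a) is load-bearing**: `[0,1]²` and `(0,1)²` (same area, they
even differ by a null set) are NOT related by a single change-of-variables move: the move's map is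
differentiable within the source at every point, hence continuous on the compact closed square,
so its image is compact — but the image must be the open square. In the free abelian group the
instance is pinned to the pair itself (`eq_of_of_sub_of_eq`). So `PlanarTransport` is right to
discard null sets, and the chain form needs rule (1a). [folklore] -/
theorem not_planarOneMove : ¬ PlanarOneMove := by
  intro h
  have hmem := h closedUnitSquare openUnitSquare (fun _ _ => rfl) (fun _ _ => rfl)
    (by rw [value_closedUnitSquare, value_openUnitSquare])
  obtain ⟨n, r₀, r₀', Φ, Φ', -, hder, -, hdom, -, hEq⟩ := hmem
  have hne : (⟨2, closedUnitSquare⟩ : Σ n, KZ.IntegralRep n) ≠ ⟨2, openUnitSquare⟩ := fun h' =>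
    openUnitSquare_ne_closedUnitSquare (by
      rw [Sigma.mk.inj_iff] at h'
      exact (eq_of_heq h'.2).symm)
  obtain ⟨h1, h2⟩ := eq_of_of_sub_of_eq hne hEq
  rw [Sigma.mk.inj_iff] at h1 h2
  obtain ⟨rfl, h1⟩ := h1
  obtain ⟨-, h2⟩ := h2
  have e1 : closedUnitSquare = r₀ := eq_of_heq h1
  have e2 : openUnitSquare = r₀' := eq_of_heq h2
  subst e1 e2
  have hcont : ContinuousOn Φ closedUnitSquare.domain := fun x hx => (hder x hx).continuousWithinAt
  have hK : IsCompact openUnitSquare.domain := by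
    rw [hdom]; exact isCompact_closedUnitSquare.image_of_continuousOn hcont
  exact not_isCompact_openUnitSquare hK

/-! ### §3b One move is not enough even between OPEN planar sets: connectedness -/

/-- Two disjoint open half-boxes `(0,½)×(0,1) ∪ (1,3/2)×(0,1)` as ONE planar set (area `1`). [folklore] -/
def twoBoxRep : KZ.IntegralRep 2 where
  domain := (boxRep ![0, 0] ![1 / 2, 1]).domain ∪ (boxRep ![1, 0] ![3 / 2, 1]).domain
  integrand := fun _ => 1
  isSemialgebraic_domain :=
    (boxRep ![0, 0] ![1 / 2, 1]).isSemialgebraic_domain.union (boxRep ![1, 0] ![3 / 2, 1]).isSemialgebraic_domain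
  isSemialgebraicFunOn_integrand := isSemialgebraicFunOn_one
    ((boxRep ![0, 0] ![1 / 2, 1]).isSemialgebraic_domain.union (boxRep ![1, 0] ![3 / 2, 1]).isSemialgebraic_domain)
  integrableOn := integrableOn_const
    (measure_union_ne_top (volume_box_ne_top _ _) (volume_box_ne_top _ _))

/-- The left half-box lies in `{x < 3/4}`, the right one in `{3/4 < x}`. [folklore] -/
theorem twoBoxRep_subset :
    twoBoxRep.domain ⊆ {p : Fin 2 → ℝ | p 0 < 3 / 4} ∪ {p : Fin 2 → ℝ | 3 / 4 < p 0} := by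
  rintro p (hp | hp)
  · left
    rw [boxRep_domain, mem_box] at hp
    have h := (hp 0).2
    simp at h
    show p 0 < 3 / 4
    linarith
  · right
    rw [boxRep_domain, mem_box] at hp
    have h := (hp 0).1
    simp at h
    show 3 / 4 < p 0
    linarith

/-- The two half-boxes are disjoint (separated by the strip `½ ≤ x ≤ 1`). [folklore] -/
theorem disjoint_halfBoxes :
    Disjoint (boxRep ![0, 0] ![1 / 2, 1]).domain (boxRep ![1, 0] ![3 / 2, 1]).domain := by
  rw [Set.disjoint_left]
  intro p hp hp'
  rw [boxRep_domain, mem_box] at hp hp'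
  have h1 := (hp 0).2
  have h2 := (hp' 0).1
  simp at h1 h2
  linarith

/-- The two-box set has area `1`. [folklore] -/
theorem value_twoBoxRep : twoBoxRep.value = 1 := by
  have hA := value_boxRep (l := ![0, 0]) (u := ![1 / 2, 1]) (fun i => by fin_cases i <;> norm_num)
  have hB := value_boxRep (l := ![1, 0]) (u := ![3 / 2, 1]) (fun i => by fin_cases i <;> norm_num)
  simp only [KZ.IntegralRep.value, boxRep_integrand] at hA hB
  have hmeas : MeasurableSet (boxRep ![1, 0] ![3 / 2, 1]).domain :=
    KZ.IntegralRep.measurableSet_domain_holds _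
  simp only [KZ.IntegralRep.value, twoBoxRep]
  rw [setIntegral_union disjoint_halfBoxes hmeas (integrableOn_const (volume_box_ne_top _ _))
    (integrableOn_const (volume_box_ne_top _ _)), hA, hB]
  norm_num

/-- The two-box set is not preconnected (the open half-planes `{x < 3/4}`, `{3/4 < x}` separate it). [folklore] -/
theorem not_isPreconnected_twoBoxRep : ¬ IsPreconnected twoBoxRep.domain := by
  intro h
  have hu : IsOpen {p : Fin 2 → ℝ | p 0 < 3 / 4} := isOpen_lt (continuous_apply 0) continuous_const
  have hv : IsOpen {p : Fin 2 → ℝ | 3 / 4 < p 0} := isOpen_lt continuous_const (continuous_apply 0)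
  have hne_u : (twoBoxRep.domain ∩ {p : Fin 2 → ℝ | p 0 < 3 / 4}).Nonempty := by
    refine ⟨![1 / 4, 1 / 2], Or.inl ?_, by show (![1 / 4, 1 / 2] : Fin 2 → ℝ) 0 < 3 / 4; simp; norm_num⟩
    rw [boxRep_domain, mem_box]
    intro i; fin_cases i <;> simp <;> norm_num
  have hne_v : (twoBoxRep.domain ∩ {p : Fin 2 → ℝ | 3 / 4 < p 0}).Nonempty := by
    refine ⟨![5 / 4, 1 / 2], Or.inr ?_, by show (3 : ℝ) / 4 < (![5 / 4, 1 / 2] : Fin 2 → ℝ) 0; simp; norm_num⟩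
    rw [boxRep_domain, mem_box]
    intro i; fin_cases i <;> simp <;> norm_num
  obtain ⟨p, -, hpu, hpv⟩ := h _ _ hu hv twoBoxRep_subset hne_u hne_v
  have h1 : p 0 < 3 / 4 := hpu
  have h2 : 3 / 4 < p 0 := hpv
  linarith

/-- NATURAL STRENGTHENING I′ (one move between OPEN planar sets of equal area). [folklore] -/
def PlanarOneMoveOpen : Prop :=
  ∀ r r' : KZ.IntegralRep 2, IsOpen r.domain → IsOpen r'.domain →
    (∀ p ∈ r.domain, r.integrand p = 1) → (∀ p ∈ r'.domain, r'.integrand p = 1) →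
    r.value = r'.value → KZ.of r - KZ.of r' ∈ KZ.changeOfVariablesRel

/-- The open unit square is open. [folklore] -/
theorem isOpen_openUnitSquare : IsOpen openUnitSquare.domain := by
  rw [boxRep_domain, box]
  exact isOpen_set_pi finite_univ fun _ _ => isOpen_Ioo

/-- The two-box set is open. [folklore] -/
theorem isOpen_twoBoxRep : IsOpen twoBoxRep.domain :=
  (isOpen_set_pi finite_univ fun _ _ => isOpen_Ioo).union
    (isOpen_set_pi finite_univ fun _ _ => isOpen_Ioo)

/-- **Refuted strengthening I′ / cutting is load-bearing beyond null-set bookkeeping**: even between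
OPEN planar sets of equal area ONE change-of-variables move may be impossible — `(0,1)²` is
preconnected (convex), a move's map is continuous on its source, so its image is preconnected, while
`(0,½)×(0,1) ∪ (1,3/2)×(0,1)` is not. A chain for this pair needs a cut (rule 1a along `x = ½`, a
null segment) before the two translations. [folklore] -/
theorem not_planarOneMoveOpen : ¬ PlanarOneMoveOpen := by
  intro h
  have hmem := h openUnitSquare twoBoxRep isOpen_openUnitSquare isOpen_twoBoxRep
    (fun _ _ => rfl) (fun _ _ => rfl) (by rw [value_openUnitSquare, value_twoBoxRep])
  obtain ⟨n, r₀, r₀', Φ, Φ', -, hder, -, hdom, -, hEq⟩ := hmem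
  have hne : (⟨2, openUnitSquare⟩ : Σ n, KZ.IntegralRep n) ≠ ⟨2, twoBoxRep⟩ := by
    intro h'
    rw [Sigma.mk.inj_iff] at h'
    have e : openUnitSquare = twoBoxRep := eq_of_heq h'.2
    have hp : (![5 / 4, 1 / 2] : Fin 2 → ℝ) ∈ twoBoxRep.domain := by
      refine Or.inr ?_
      rw [boxRep_domain, mem_box]
      intro i; fin_cases i <;> simp <;> norm_num
    rw [← e, mem_openUnitSquare] at hp
    norm_num at hp
  obtain ⟨h1, h2⟩ := eq_of_of_sub_of_eq hne hEq
  rw [Sigma.mk.inj_iff] at h1 h2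
  obtain ⟨rfl, h1⟩ := h1
  obtain ⟨-, h2⟩ := h2
  have e1 : openUnitSquare = r₀ := eq_of_heq h1
  have e2 : twoBoxRep = r₀' := eq_of_heq h2
  subst e1 e2
  have hcont : ContinuousOn Φ openUnitSquare.domain := fun x hx => (hder x hx).continuousWithinAt
  have hconv : Convex ℝ openUnitSquare.domain := by
    rw [boxRep_domain, box]
    exact convex_pi fun _ _ => convex_Ioo _ _
  have hpre : IsPreconnected twoBoxRep.domain := by
    rw [hdom]; exact hconv.isPreconnected.image Φ hcont
  exact not_isPreconnected_twoBoxRep hpre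

/-- NATURAL STRENGTHENING II: curved scissors (rule 1a) alone, inside the planar sets. [folklore] -/
def PlanarScissorsOnly : Prop :=
  ∀ r r' : KZ.IntegralRep 2, (∀ p ∈ r.domain, r.integrand p = 1) →
    (∀ p ∈ r'.domain, r'.integrand p = 1) → r.value = r'.value →
    KZ.of r - KZ.of r' ∈ AddSubgroup.closure (KZ.domainAddRel ∩
      (AddSubgroup.closure planarGens : Set KZ.FormalRep))

/-- The unit-cube windows `(0,1)ⁿ`, one per dimension. [folklore] -/
def unitWindow : (n : ℕ) → Set (Fin n → ℝ) := fun n => Set.pi univ fun _ : Fin n => Ioo (0 : ℝ) 1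

/-- The windows are measurable. [folklore] -/
theorem measurableSet_unitWindow (n : ℕ) : MeasurableSet (unitWindow n) :=
  MeasurableSet.univ_pi fun _ => measurableSet_Ioo

/-- The open unit square is the window of dimension `2`. [folklore] -/
theorem openUnitSquare_domain_eq_unitWindow : openUnitSquare.domain = unitWindow 2 := by
  ext p; simp [mem_box, unitWindow, Fin.forall_fin_two]

/-- **Refuted strengthening / rule (2) is load-bearing**: `(0,1)²` and its translate `(2,3) × (0,1)`
have the same area but are NOT related by curved scissors alone: domain additivity preserves the
area seen through the fixed window `(0,1)²` (`KZ.restrictedEval`), which is `1` for the first and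
`0` for the second. [folklore] -/
theorem not_planarScissorsOnly : ¬ PlanarScissorsOnly := by
  intro h
  have hmem := h openUnitSquare (boxRep ![2, 0] ![3, 1]) (fun _ _ => rfl) (fun _ _ => rfl)
    (by rw [value_openUnitSquare, value_boxRep (fun i => by fin_cases i <;> norm_num)]; norm_num)
  have hle : AddSubgroup.closure (KZ.domainAddRel ∩
      (AddSubgroup.closure planarGens : Set KZ.FormalRep)) ≤ (KZ.restrictedEval unitWindow).ker :=
    (AddSubgroup.closure_mono (fun c hc => Or.inl hc.1)).trans
      (KZ.closure_add_le_ker_restrictedEval unitWindow measurableSet_unitWindow)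
  have h0 := AddMonoidHom.mem_ker.mp (hle hmem)
  have hA : openUnitSquare.domain ∩ unitWindow 2 = openUnitSquare.domain := by
    rw [openUnitSquare_domain_eq_unitWindow, inter_self]
  have hB : (boxRep ![2, 0] ![3, 1]).domain ∩ unitWindow 2 = ∅ := by
    ext p
    simp only [mem_inter_iff, mem_empty_iff_false, iff_false]
    rintro ⟨hp, hw⟩
    rw [boxRep_domain, mem_box] at hp
    have h1 := (hp 0).1
    have h2 := (hw 0 (mem_univ _)).2
    simp at h1 h2
    linarith
  have hval := value_openUnitSquare
  simp only [KZ.IntegralRep.value] at hval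
  rw [map_sub, KZ.restrictedEval_of, KZ.restrictedEval_of, hA, hB, hval] at h0
  simp at h0

/-! ## §5 Calibrations: candidate invariants that die by ONE explicit move (templates for provers) -/

/-- The hyperbolic dilation `diag(2, 1/2)` as a continuous linear map of the plane. [folklore] -/
def hypDilation : (Fin 2 → ℝ) →L[ℝ] (Fin 2 → ℝ) :=
  LinearMap.toContinuousLinearMap (Matrix.toLin' !![(2 : ℝ), 0; 0, 1 / 2])

/-- The hyperbolic dilation in coordinates. [folklore] -/
theorem hypDilation_apply (p : Fin 2 → ℝ) : hypDilation p = ![2 * p 0, p 1 / 2] := by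
  ext i
  fin_cases i <;> simp [hypDilation, Matrix.toLin'_apply, Matrix.mulVec, dotProduct,
    Fin.sum_univ_two, div_eq_mul_inv, mul_comm]

/-- The hyperbolic dilation has determinant `1`. [folklore] -/
theorem det_hypDilation : hypDilation.det = 1 := by
  rw [hypDilation, LinearMap.det_toContinuousLinearMap, LinearMap.det_toLin', Matrix.det_fin_two]
  simp

/-- The hyperbolic dilation is a polynomial map with rational coefficients, hence ℚ-semialgebraic
on every ℚ-semialgebraic set. [folklore] -/
theorem isSemialgebraicMapOn_hypDilation {s : Set (Fin 2 → ℝ)} (hs : IsSemialgebraic ℚ s) :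
    IsSemialgebraicMapOn ℚ s hypDilation := by
  refine (isSemialgebraicMapOn_aeval hs ![2 * X 0, C (1 / 2 : ℚ) * X 1]).congr fun p _ => ?_
  rw [hypDilation_apply]
  ext j
  fin_cases j <;> simp [div_eq_inv_mul, mul_comm]

/-- The hyperbolic dilation is injective. [folklore] -/
theorem injective_hypDilation : Function.Injective hypDilation := by
  intro p q h
  rw [hypDilation_apply, hypDilation_apply] at h
  have h0 := congrFun h 0
  have h1 := congrFun h 1
  simp at h0 h1
  ext i
  fin_cases i
  · simpa using h0
  · simpa using h1

/-- The hyperbolic dilation maps `(0,1)²` onto `(0,2) × (0,1/2)`. [folklore] -/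
theorem image_hypDilation_openUnitSquare :
    hypDilation '' openUnitSquare.domain = (boxRep ![0, 0] ![2, 1 / 2]).domain := by
  ext q
  constructor
  · rintro ⟨p, hp, rfl⟩
    rw [mem_openUnitSquare] at hp
    rw [boxRep_domain, mem_box, hypDilation_apply]
    intro i
    fin_cases i <;> simp <;> constructor <;> linarith [hp.1.1, hp.1.2, hp.2.1, hp.2.2]
  · intro hq
    rw [boxRep_domain, mem_box] at hq
    have h0 := hq 0
    have h1 := hq 1
    simp at h0 h1
    refine ⟨![q 0 / 2, 2 * q 1], ?_, ?_⟩
    · rw [mem_openUnitSquare]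
      simp
      refine ⟨⟨by linarith, by linarith⟩, by linarith, by linarith⟩
    · rw [hypDilation_apply]
      ext i
      fin_cases i
      · simp [mul_div_cancel₀]
      · simp

/-- **ASPECT RATIO IS NOT AN INVARIANT** (calibration): `[(0,1)²] − [(0,2) × (0,½)]` is ONE
change-of-variables move, via `diag(2, ½)` (|det| = 1, rational entries). Template for every affine
symplectic move between planar sets. [folklore] -/
theorem of_openUnitSquare_sub_of_flatBox_mem_changeOfVariablesRel :
    KZ.of openUnitSquare - KZ.of (boxRep ![0, 0] ![2, 1 / 2]) ∈ KZ.changeOfVariablesRel :=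
  ⟨2, openUnitSquare, boxRep ![0, 0] ![2, 1 / 2], hypDilation, fun _ => hypDilation,
    isSemialgebraicMapOn_hypDilation openUnitSquare.isSemialgebraic_domain,
    fun x _ => hypDilation.hasFDerivAt.hasFDerivWithinAt, injective_hypDilation.injOn,
    image_hypDilation_openUnitSquare.symm, fun x _ => by simp [det_hypDilation], rfl⟩

/-- Hence the unit square and the flat box are congruent in the planar set-chain group
(equal area `1`, different shape): the smallest honest instance of the crux. [folklore] -/
theorem of_openUnitSquare_sub_of_flatBox_mem_planarGroup :
    KZ.of openUnitSquare - KZ.of (boxRep ![0, 0] ![2, 1 / 2]) ∈ planarGroup :=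
  AddSubgroup.subset_closure ⟨Or.inr of_openUnitSquare_sub_of_flatBox_mem_changeOfVariablesRel,
    (AddSubgroup.closure planarGens).sub_mem (AddSubgroup.subset_closure ⟨_, fun _ _ => rfl, rfl⟩)
      (AddSubgroup.subset_closure ⟨_, fun _ _ => rfl, rfl⟩)⟩

/-! ## §6 The Dehn form of the crux: invariants -/

/-- The generating move set of the planar set-chain group: planar instances of rules 1a and 2. [folklore] -/
def planarMoves : Set KZ.FormalRep :=
  (KZ.domainAddRel ∪ KZ.changeOfVariablesRel) ∩ (AddSubgroup.closure planarGens : Set KZ.FormalRep)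

/-- Unfolding. [folklore] -/
theorem planarGroup_eq_closure_planarMoves : planarGroup = AddSubgroup.closure planarMoves := rfl

/-- **DEHN FORM OF THE CRUX.** `PlanarK0Injective` holds iff every additive invariant of formal
combinations of representations that vanishes on the planar moves (planar instances of 1a and 2)
takes equal values on planar sets of equal area. (`→`: the kernel of such an invariant contains
`planarGroup`; `←`: the quotient map `FormalRep → FormalRep ⧸ planarGroup` is such an invariant.)
So a refutation IS a "curved Dehn invariant" and nothing else. [folklore] -/
theorem planarK0Injective_iff_forall_invariant :
    PlanarK0Injective ↔ ∀ (A : Type) [AddCommGroup A] (h : KZ.FormalRep →+ A),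
      (∀ c ∈ planarMoves, h c = 0) →
      ∀ r r' : KZ.IntegralRep 2, (∀ p ∈ r.domain, r.integrand p = 1) →
        (∀ p ∈ r'.domain, r'.integrand p = 1) → r.value = r'.value → h (KZ.of r) = h (KZ.of r') := by
  constructor
  · intro hP A _ h hh r r' hr hr' hv
    have hmem := hP r r' hr hr' hv
    have hle : planarGroup ≤ h.ker := (AddSubgroup.closure_le _).mpr fun c hc => hh c hc
    have h0 := hle hmem
    rwa [AddMonoidHom.mem_ker, map_sub, sub_eq_zero] at h0
  · intro H r r' hr hr' hv
    have h := H (KZ.FormalRep ⧸ planarGroup) (QuotientAddGroup.mk' planarGroup) (fun c hc => ?_)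
      r r' hr hr' hv
    · rwa [← sub_eq_zero, ← map_sub, QuotientAddGroup.mk'_apply, QuotientAddGroup.eq_zero_iff] at h
    · rw [QuotientAddGroup.mk'_apply, QuotientAddGroup.eq_zero_iff]
      exact AddSubgroup.subset_closure hc

/-! ## §7 Orientation is not load-bearing: the mirror pair is ONE oriented move -/

/-- The ORIENTED change-of-variables instances: rule 2 with `det Φ' = 1` (not merely `|det| = 1`). [folklore] -/
def orientedChangeOfVariablesRel : Set KZ.FormalRep :=
  {c | ∃ (n : ℕ) (r r' : KZ.IntegralRep n) (Φ : (Fin n → ℝ) → (Fin n → ℝ))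
      (Φ' : (Fin n → ℝ) → (Fin n → ℝ) →L[ℝ] (Fin n → ℝ)),
    IsSemialgebraicMapOn ℚ r.domain Φ ∧ (∀ x ∈ r.domain, HasFDerivWithinAt Φ (Φ' x) r.domain x) ∧
    InjOn Φ r.domain ∧ r'.domain = Φ '' r.domain ∧
    (∀ x ∈ r.domain, r.integrand x = r'.integrand (Φ x) * |(Φ' x).det|) ∧
    (∀ x ∈ r.domain, (Φ' x).det = 1) ∧ c = KZ.of r - KZ.of r'}

/-- Oriented instances are instances. [folklore] -/
theorem orientedChangeOfVariablesRel_subset : orientedChangeOfVariablesRel ⊆ KZ.changeOfVariablesRel := by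
  rintro c ⟨n, r, r', Φ, Φ', h1, h2, h3, h4, h5, -, h7⟩
  exact ⟨n, r, r', Φ, Φ', h1, h2, h3, h4, h5, h7⟩

/-- The curvilinear triangle under the parabola: `{0 < x < 1, 0 < y < x²}`. [folklore] -/
def parabolaSet : Set (Fin 2 → ℝ) := {p | 0 < p 0 ∧ p 0 < 1 ∧ 0 < p 1 ∧ p 1 < p 0 ^ 2}

/-- Its mirror image in the line `x = ½`: `{0 < x < 1, 0 < y < (1 − x)²}`. [folklore] -/
def mirrorParabolaSet : Set (Fin 2 → ℝ) := {p | 0 < p 0 ∧ p 0 < 1 ∧ 0 < p 1 ∧ p 1 < (1 - p 0) ^ 2}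

/-- Auxiliary: `isSemialgebraic_parabolaSet`. [folklore] -/
theorem isSemialgebraic_parabolaSet : IsSemialgebraic ℚ parabolaSet := by
  have h := (((isSemialgebraic_setOf_eval_lt (k := ℚ) (R := ℝ) (ι := Fin 2) (C 0) (X 0)).inter
    (isSemialgebraic_setOf_eval_lt (k := ℚ) (R := ℝ) (ι := Fin 2) (X 0) (C 1))).inter
    (isSemialgebraic_setOf_eval_lt (k := ℚ) (R := ℝ) (ι := Fin 2) (C 0) (X 1))).inter
    (isSemialgebraic_setOf_eval_lt (k := ℚ) (R := ℝ) (ι := Fin 2) (X 1) (X 0 ^ 2))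
  have hEq : parabolaSet =
      (({x : Fin 2 → ℝ | aeval x (C 0 : MvPolynomial (Fin 2) ℚ) < aeval x (X 0 : MvPolynomial (Fin 2) ℚ)} ∩
      {x : Fin 2 → ℝ | aeval x (X 0 : MvPolynomial (Fin 2) ℚ) < aeval x (C 1 : MvPolynomial (Fin 2) ℚ)}) ∩
      {x : Fin 2 → ℝ | aeval x (C 0 : MvPolynomial (Fin 2) ℚ) < aeval x (X 1 : MvPolynomial (Fin 2) ℚ)}) ∩
      {x : Fin 2 → ℝ | aeval x (X 1 : MvPolynomial (Fin 2) ℚ) < aeval x (X 0 ^ 2 : MvPolynomial (Fin 2) ℚ)} := by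
    ext p
    simp [parabolaSet, and_assoc]
  rw [hEq]; exact h

/-- Auxiliary: `isSemialgebraic_mirrorParabolaSet`. [folklore] -/
theorem isSemialgebraic_mirrorParabolaSet : IsSemialgebraic ℚ mirrorParabolaSet := by
  have h := (((isSemialgebraic_setOf_eval_lt (k := ℚ) (R := ℝ) (ι := Fin 2) (C 0) (X 0)).inter
    (isSemialgebraic_setOf_eval_lt (k := ℚ) (R := ℝ) (ι := Fin 2) (X 0) (C 1))).inter
    (isSemialgebraic_setOf_eval_lt (k := ℚ) (R := ℝ) (ι := Fin 2) (C 0) (X 1))).inter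
    (isSemialgebraic_setOf_eval_lt (k := ℚ) (R := ℝ) (ι := Fin 2) (X 1) ((C 1 - X 0) ^ 2))
  have hEq : mirrorParabolaSet =
      (({x : Fin 2 → ℝ | aeval x (C 0 : MvPolynomial (Fin 2) ℚ) < aeval x (X 0 : MvPolynomial (Fin 2) ℚ)} ∩
      {x : Fin 2 → ℝ | aeval x (X 0 : MvPolynomial (Fin 2) ℚ) < aeval x (C 1 : MvPolynomial (Fin 2) ℚ)}) ∩
      {x : Fin 2 → ℝ | aeval x (C 0 : MvPolynomial (Fin 2) ℚ) < aeval x (X 1 : MvPolynomial (Fin 2) ℚ)}) ∩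
      {x : Fin 2 → ℝ | aeval x (X 1 : MvPolynomial (Fin 2) ℚ) <
        aeval x ((C 1 - X 0) ^ 2 : MvPolynomial (Fin 2) ℚ)} := by
    ext p
    simp [mirrorParabolaSet, and_assoc]
  rw [hEq]; exact h

/-- Auxiliary: `parabolaSet_subset_Icc`. [folklore] -/
theorem parabolaSet_subset_Icc : parabolaSet ⊆ Icc (0 : Fin 2 → ℝ) 1 := by
  rintro p ⟨h0, h1, h2, h3⟩
  have hsq : p 0 ^ 2 < 1 := by nlinarith
  refine ⟨fun i => ?_, fun i => ?_⟩ <;> fin_cases i <;> simp <;> linarith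

/-- Auxiliary: `mirrorParabolaSet_subset_Icc`. [folklore] -/
theorem mirrorParabolaSet_subset_Icc : mirrorParabolaSet ⊆ Icc (0 : Fin 2 → ℝ) 1 := by
  rintro p ⟨h0, h1, h2, h3⟩
  have hsq : (1 - p 0) ^ 2 < 1 := by nlinarith
  refine ⟨fun i => ?_, fun i => ?_⟩ <;> fin_cases i <;> simp <;> linarith

/-- Auxiliary: `volume_Icc01_lt_top`. [folklore] -/
theorem volume_Icc01_lt_top : volume (Icc (0 : Fin 2 → ℝ) 1) < ⊤ := isCompact_Icc.measure_lt_top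

/-- The parabola region as a planar set. [folklore] -/
def parabolaRep : KZ.IntegralRep 2 where
  domain := parabolaSet
  integrand := fun _ => 1
  isSemialgebraic_domain := isSemialgebraic_parabolaSet
  isSemialgebraicFunOn_integrand := isSemialgebraicFunOn_one isSemialgebraic_parabolaSet
  integrableOn := integrableOn_const
    ((measure_mono parabolaSet_subset_Icc).trans_lt volume_Icc01_lt_top).ne

/-- The mirrored parabola region as a planar set. [folklore] -/
def mirrorParabolaRep : KZ.IntegralRep 2 where
  domain := mirrorParabolaSet
  integrand := fun _ => 1
  isSemialgebraic_domain := isSemialgebraic_mirrorParabolaSet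
  isSemialgebraicFunOn_integrand := isSemialgebraicFunOn_one isSemialgebraic_mirrorParabolaSet
  integrableOn := integrableOn_const
    ((measure_mono mirrorParabolaSet_subset_Icc).trans_lt volume_Icc01_lt_top).ne

/-- The oriented polynomial move `Φ(x, y) = (1 − x, x² − y)` (rotation by `π` about `(½, ½)`
followed by the shear `(x, y) ↦ (x, y − 1 + (1 − x)²)`; `det DΦ = (−1)(−1) = 1`). [folklore] -/
def mirrorMap : (Fin 2 → ℝ) → (Fin 2 → ℝ) := fun p => ![1 - p 0, p 0 ^ 2 - p 1]

/-- Coordinate projections of the plane as continuous linear forms. [folklore] -/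
abbrev pr (i : Fin 2) : (Fin 2 → ℝ) →L[ℝ] ℝ := ContinuousLinearMap.proj (R := ℝ) (φ := fun _ : Fin 2 => ℝ) i

/-- Its derivative at `p`: `v ↦ (−v₀, 2 p₀ v₀ − v₁)`. [folklore] -/
def mirrorMapDeriv (p : Fin 2 → ℝ) : (Fin 2 → ℝ) →L[ℝ] (Fin 2 → ℝ) :=
  ContinuousLinearMap.pi ![-(pr 0), (2 * p 0) • pr 0 - pr 1]

/-- Auxiliary: `mirrorMapDeriv_apply`. [folklore] -/
theorem mirrorMapDeriv_apply (p v : Fin 2 → ℝ) :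
    mirrorMapDeriv p v = ![-v 0, 2 * p 0 * v 0 - v 1] := by
  ext i
  fin_cases i <;> simp [mirrorMapDeriv, mul_assoc, sub_eq_add_neg]

/-- Auxiliary: `hasFDerivAt_mirrorMap_fst`. [folklore] -/
theorem hasFDerivAt_mirrorMap_fst (p : Fin 2 → ℝ) :
    HasFDerivAt (fun q : Fin 2 → ℝ => 1 - q 0) (-(pr 0)) p := by
  simpa using ((pr 0).hasFDerivAt (x := p)).const_sub 1

/-- Auxiliary: `hasFDerivAt_mirrorMap_snd`. [folklore] -/
theorem hasFDerivAt_mirrorMap_snd (p : Fin 2 → ℝ) :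
    HasFDerivAt (fun q : Fin 2 → ℝ => q 0 ^ 2 - q 1) ((2 * p 0) • pr 0 - pr 1) p := by
  have h := (((pr 0).hasFDerivAt (x := p)).pow 2).sub ((pr 1).hasFDerivAt (x := p))
  refine h.congr_fderiv ?_
  ext v
  simp [two_mul, add_mul]

/-- Auxiliary: `hasFDerivAt_mirrorMap`. [folklore] -/
theorem hasFDerivAt_mirrorMap (p : Fin 2 → ℝ) : HasFDerivAt mirrorMap (mirrorMapDeriv p) p := by
  rw [hasFDerivAt_pi']
  refine Fin.forall_fin_two.mpr ⟨?_, ?_⟩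
  · have e : -(pr 0) = (pr 0).comp (mirrorMapDeriv p) := by
      ext v; simp [mirrorMapDeriv]
    exact (hasFDerivAt_mirrorMap_fst p).congr_fderiv e
  · have e : (2 * p 0) • pr 0 - pr 1 = (pr 1).comp (mirrorMapDeriv p) := by
      ext v; simp [mirrorMapDeriv]
    exact (hasFDerivAt_mirrorMap_snd p).congr_fderiv e

/-- Auxiliary: `det_mirrorMapDeriv`. [folklore] -/
theorem det_mirrorMapDeriv (p : Fin 2 → ℝ) : (mirrorMapDeriv p).det = 1 := by
  have h : (mirrorMapDeriv p : (Fin 2 → ℝ) →ₗ[ℝ] (Fin 2 → ℝ)) =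
      Matrix.toLin' !![(-1 : ℝ), 0; 2 * p 0, -1] := by
    apply LinearMap.ext
    intro v
    rw [ContinuousLinearMap.coe_coe, mirrorMapDeriv_apply, Matrix.toLin'_apply]
    ext i
    fin_cases i <;> simp [Matrix.mulVec, dotProduct, Fin.sum_univ_two, sub_eq_add_neg]
  rw [ContinuousLinearMap.det, h, LinearMap.det_toLin', Matrix.det_fin_two]
  simp

/-- Auxiliary: `isSemialgebraicMapOn_mirrorMap`. [folklore] -/
theorem isSemialgebraicMapOn_mirrorMap {s : Set (Fin 2 → ℝ)} (hs : IsSemialgebraic ℚ s) :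
    IsSemialgebraicMapOn ℚ s mirrorMap := by
  refine (isSemialgebraicMapOn_aeval hs ![C 1 - X 0, X 0 ^ 2 - X 1]).congr fun p _ => ?_
  ext j
  fin_cases j <;> simp [mirrorMap]

/-- Auxiliary: `mirrorMap_apply`. [folklore] -/
theorem mirrorMap_apply (p : Fin 2 → ℝ) : mirrorMap p = ![1 - p 0, p 0 ^ 2 - p 1] := rfl

/-- Auxiliary: `injective_mirrorMap` (indeed an involution up to the shear). [folklore] -/
theorem injective_mirrorMap : Function.Injective mirrorMap := by
  intro p q h
  have h0 := congrFun h 0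
  have h1 := congrFun h 1
  simp [mirrorMap] at h0 h1
  rw [h0] at h1
  ext i
  fin_cases i
  · simpa using h0
  · simp; linarith

/-- Auxiliary: `image_mirrorMap_parabolaSet`. [folklore] -/
theorem image_mirrorMap_parabolaSet : mirrorMap '' parabolaSet = mirrorParabolaSet := by
  ext q
  constructor
  · rintro ⟨p, ⟨h0, h1, h2, h3⟩, rfl⟩
    refine ⟨?_, ?_, ?_, ?_⟩ <;> simp [mirrorMap] <;> nlinarith
  · rintro ⟨h0, h1, h2, h3⟩
    refine ⟨![1 - q 0, (1 - q 0) ^ 2 - q 1], ⟨?_, ?_, ?_, ?_⟩, ?_⟩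
    · simp; linarith
    · simp; linarith
    · simp; linarith
    · simp
      linarith
    · rw [mirrorMap_apply]
      ext i
      fin_cases i <;> simp

/-- **ORIENTATION IS NOT LOAD-BEARING (calibration).** The parabola region `{0<x<1, 0<y<x²}`
and its mirror image `{0<x<1, 0<y<(1−x)²}` differ by ONE change-of-variables move whose map is
a polynomial with rational coefficients and Jacobian determinant `+1` everywhere
(`Φ(x,y) = (1 − x, x² − y)` = rotation by `π` then a vertical shear). So reflections (`det = −1`)
are dispensable for this chiral pair; on paper the same rotation-plus-shear trick turns EVERY
mirror image of a subgraph cell into an oriented move, so chirality is no invariant and the `|·|`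
in `|det Φ'| = 1` is (conjecturally) never needed between planar sets. [folklore] -/
theorem parabola_mirror_mem_orientedChangeOfVariablesRel :
    KZ.of parabolaRep - KZ.of mirrorParabolaRep ∈ orientedChangeOfVariablesRel :=
  ⟨2, parabolaRep, mirrorParabolaRep, mirrorMap, mirrorMapDeriv,
    isSemialgebraicMapOn_mirrorMap isSemialgebraic_parabolaSet,
    fun p _ => (hasFDerivAt_mirrorMap p).hasFDerivWithinAt, injective_mirrorMap.injOn,
    image_mirrorMap_parabolaSet.symm, fun p _ => by simp [parabolaRep, mirrorParabolaRep, det_mirrorMapDeriv],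
    fun p _ => det_mirrorMapDeriv p, rfl⟩

/-- Hence the chiral pair is congruent in the planar set-chain group by one oriented move. [folklore] -/
theorem parabola_mirror_mem_planarGroup :
    KZ.of parabolaRep - KZ.of mirrorParabolaRep ∈ planarGroup :=
  AddSubgroup.subset_closure ⟨Or.inr (orientedChangeOfVariablesRel_subset
      parabola_mirror_mem_orientedChangeOfVariablesRel),
    (AddSubgroup.closure planarGens).sub_mem (AddSubgroup.subset_closure ⟨_, fun _ _ => rfl, rfl⟩)
      (AddSubgroup.subset_closure ⟨_, fun _ _ => rfl, rfl⟩)⟩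

/-! ## §8 Boundedness is not a one-move invariant: the horn is ONE move from the square -/

/-- The unbounded horn `{x > 1, 0 < y, x² y < 1}` (area `1`). [folklore] -/
def hornSet : Set (Fin 2 → ℝ) := {p | 1 < p 0 ∧ 0 < p 1 ∧ p 0 ^ 2 * p 1 < 1}

/-- Auxiliary: `isSemialgebraic_hornSet`. [folklore] -/
theorem isSemialgebraic_hornSet : IsSemialgebraic ℚ hornSet := by
  have h := ((isSemialgebraic_setOf_eval_lt (k := ℚ) (R := ℝ) (ι := Fin 2) (C 1) (X 0)).inter
    (isSemialgebraic_setOf_eval_lt (k := ℚ) (R := ℝ) (ι := Fin 2) (C 0) (X 1))).inter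
    (isSemialgebraic_setOf_eval_lt (k := ℚ) (R := ℝ) (ι := Fin 2) (X 0 ^ 2 * X 1) (C 1))
  have hEq : hornSet =
      ({x : Fin 2 → ℝ | aeval x (C 1 : MvPolynomial (Fin 2) ℚ) < aeval x (X 0 : MvPolynomial (Fin 2) ℚ)} ∩
      {x : Fin 2 → ℝ | aeval x (C 0 : MvPolynomial (Fin 2) ℚ) < aeval x (X 1 : MvPolynomial (Fin 2) ℚ)}) ∩
      {x : Fin 2 → ℝ | aeval x (X 0 ^ 2 * X 1 : MvPolynomial (Fin 2) ℚ) < aeval x (C 1 : MvPolynomial (Fin 2) ℚ)} := by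
    ext p
    simp [hornSet, and_assoc]
  rw [hEq]; exact h

/-- The compactification map `Φ(x, y) = (1/x, x² y)` (`det DΦ = −1`). [folklore] -/
def hornMap : (Fin 2 → ℝ) → (Fin 2 → ℝ) := fun p => ![(p 0)⁻¹, p 0 ^ 2 * p 1]

/-- Its derivative at `p`: `v ↦ (−v₀/x², 2xy·v₀ + x²·v₁)`. [folklore] -/
def hornMapDeriv (p : Fin 2 → ℝ) : (Fin 2 → ℝ) →L[ℝ] (Fin 2 → ℝ) :=
  ContinuousLinearMap.pi ![-(p 0 ^ 2)⁻¹ • pr 0, (2 * p 0 * p 1) • pr 0 + (p 0 ^ 2) • pr 1]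

/-- Auxiliary: `hornMapDeriv_apply`. [folklore] -/
theorem hornMapDeriv_apply (p v : Fin 2 → ℝ) :
    hornMapDeriv p v = ![-(p 0 ^ 2)⁻¹ * v 0, 2 * p 0 * p 1 * v 0 + p 0 ^ 2 * v 1] := by
  ext i
  fin_cases i <;> simp [hornMapDeriv]

/-- Auxiliary: `hasFDerivAt_hornMap_fst`. [folklore] -/
theorem hasFDerivAt_hornMap_fst {p : Fin 2 → ℝ} (hp : p 0 ≠ 0) :
    HasFDerivAt (fun q : Fin 2 → ℝ => (q 0)⁻¹) (-(p 0 ^ 2)⁻¹ • pr 0) p := by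
  have h := (hasFDerivAt_inv (𝕜 := ℝ) hp).comp p ((pr 0).hasFDerivAt (x := p))
  refine h.congr_fderiv ?_
  ext v
  simp [ContinuousLinearMap.toSpanSingleton_apply, mul_comm]

/-- Auxiliary: `hasFDerivAt_hornMap_snd`. [folklore] -/
theorem hasFDerivAt_hornMap_snd (p : Fin 2 → ℝ) :
    HasFDerivAt (fun q : Fin 2 → ℝ => q 0 ^ 2 * q 1) ((2 * p 0 * p 1) • pr 0 + (p 0 ^ 2) • pr 1) p := by
  have h := (((pr 0).hasFDerivAt (x := p)).pow 2).mul ((pr 1).hasFDerivAt (x := p))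
  refine h.congr_fderiv ?_
  ext v
  simp
  ring

/-- Auxiliary: `hasFDerivAt_hornMap`. [folklore] -/
theorem hasFDerivAt_hornMap {p : Fin 2 → ℝ} (hp : p 0 ≠ 0) : HasFDerivAt hornMap (hornMapDeriv p) p := by
  rw [hasFDerivAt_pi']
  refine Fin.forall_fin_two.mpr ⟨?_, ?_⟩
  · have e : -(p 0 ^ 2)⁻¹ • pr 0 = (pr 0).comp (hornMapDeriv p) := by
      ext v; simp [hornMapDeriv]
    exact (hasFDerivAt_hornMap_fst hp).congr_fderiv e
  · have e : (2 * p 0 * p 1) • pr 0 + (p 0 ^ 2) • pr 1 = (pr 1).comp (hornMapDeriv p) := by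
      ext v; simp [hornMapDeriv]
    exact (hasFDerivAt_hornMap_snd p).congr_fderiv e

/-- Auxiliary: `det_hornMapDeriv`. [folklore] -/
theorem det_hornMapDeriv {p : Fin 2 → ℝ} (hp : p 0 ≠ 0) : (hornMapDeriv p).det = -1 := by
  have h : (hornMapDeriv p : (Fin 2 → ℝ) →ₗ[ℝ] (Fin 2 → ℝ)) =
      Matrix.toLin' !![-(p 0 ^ 2)⁻¹, 0; 2 * p 0 * p 1, p 0 ^ 2] := by
    apply LinearMap.ext
    intro v
    rw [ContinuousLinearMap.coe_coe, hornMapDeriv_apply, Matrix.toLin'_apply]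
    ext i
    fin_cases i <;> simp [Matrix.mulVec, dotProduct, Fin.sum_univ_two]
  rw [ContinuousLinearMap.det, h, LinearMap.det_toLin', Matrix.det_fin_two]
  have h2 : p 0 ^ 2 ≠ 0 := pow_ne_zero 2 hp
  simp [h2]

/-- Auxiliary: `isSemialgebraicMapOn_hornMap`. [folklore] -/
theorem isSemialgebraicMapOn_hornMap : IsSemialgebraicMapOn ℚ hornSet hornMap := by
  refine IsSemialgebraicMapOn.of_forall isSemialgebraic_hornSet (Fin.forall_fin_two.mpr ⟨?_, ?_⟩)
  · refine (isSemialgebraicFunOn_aeval_div_aeval isSemialgebraic_hornSet (C 1) (X 0) ?_).congr ?_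
    · intro x hx
      have h1 : 1 < x 0 := hx.1
      simp only [aeval_X, ne_eq]
      exact ne_of_gt (by linarith)
    · intro x _
      simp [hornMap]
  · exact (isSemialgebraicFunOn_aeval isSemialgebraic_hornSet (X 0 ^ 2 * X 1)).congr
      fun x _ => by simp [hornMap]

/-- Auxiliary: `injOn_hornMap`. [folklore] -/
theorem injOn_hornMap : InjOn hornMap hornSet := by
  intro p hp q hq h
  have hp0 : p 0 ≠ 0 := ne_of_gt (by linarith [hp.1])
  have hq0 : q 0 ≠ 0 := ne_of_gt (by linarith [hq.1])
  have h0 := congrFun h 0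
  have h1 := congrFun h 1
  simp only [hornMap, Matrix.cons_val_zero, Matrix.cons_val_one, inv_inj] at h0 h1
  rw [h0] at h1
  have h1' : p 1 = q 1 := by
    have := mul_left_cancel₀ (pow_ne_zero 2 hq0) h1
    exact this
  ext i
  fin_cases i
  · exact h0
  · exact h1'

/-- Auxiliary: `image_hornMap_hornSet` — the horn goes onto the open unit square. [folklore] -/
theorem image_hornMap_hornSet : hornMap '' hornSet = openUnitSquare.domain := by
  ext q
  rw [mem_openUnitSquare]
  constructor
  · rintro ⟨p, ⟨h0, h1, h2⟩, rfl⟩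
    have hp0 : 0 < p 0 := by linarith
    refine ⟨⟨?_, ?_⟩, ?_, ?_⟩
    · simp only [hornMap, Matrix.cons_val_zero]; exact inv_pos.mpr hp0
    · simp only [hornMap, Matrix.cons_val_zero]; exact inv_lt_one_of_one_lt₀ h0
    · simp only [hornMap, Matrix.cons_val_one, Matrix.cons_val_zero]; positivity
    · simpa [hornMap] using h2
  · rintro ⟨⟨h0, h1⟩, h2, h3⟩
    have hq0 : q 0 ≠ 0 := h0.ne'
    refine ⟨![(q 0)⁻¹, q 0 ^ 2 * q 1], ⟨?_, ?_, ?_⟩, ?_⟩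
    · simp; exact one_lt_inv_iff₀.mpr ⟨h0, h1⟩
    · simp; positivity
    · simp; field_simp; exact h3
    · simp only [hornMap]
      ext i
      fin_cases i
      · simp
      · simp; field_simp

/-- Auxiliary: `measurableSet_hornSet`. [folklore] -/
theorem measurableSet_hornSet : MeasurableSet hornSet :=
  IsSemialgebraic.measurableSet_holds isSemialgebraic_hornSet

/-- Auxiliary: `ne_zero_of_mem_hornSet`. [folklore] -/
theorem ne_zero_of_mem_hornSet {p : Fin 2 → ℝ} (hp : p ∈ hornSet) : p 0 ≠ 0 :=
  ne_of_gt (lt_trans zero_lt_one hp.1)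

/-- The horn has the area of the unit square (Jacobian formula for the compactification map,
`|det| = 1`): in particular it has finite area although it is unbounded. [folklore] -/
theorem volume_hornSet : volume hornSet = volume openUnitSquare.domain := by
  have h := lintegral_abs_det_fderiv_eq_addHaar_image volume measurableSet_hornSet
    (fun p hp => (hasFDerivAt_hornMap (ne_zero_of_mem_hornSet hp)).hasFDerivWithinAt) injOn_hornMap
  rw [image_hornMap_hornSet] at h
  rw [← h]
  have hcongr : EqOn (fun p => ENNReal.ofReal |(hornMapDeriv p).det|) (fun _ => 1) hornSet :=
    fun p hp => by simp [det_hornMapDeriv (ne_zero_of_mem_hornSet hp)]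
  rw [setLIntegral_congr_fun measurableSet_hornSet hcongr]
  simp

/-- The horn as a planar set (integrand `1`, area `1`). [folklore] -/
def hornRep : KZ.IntegralRep 2 where
  domain := hornSet
  integrand := fun _ => 1
  isSemialgebraic_domain := isSemialgebraic_hornSet
  isSemialgebraicFunOn_integrand := isSemialgebraicFunOn_one isSemialgebraic_hornSet
  integrableOn := integrableOn_const (by rw [volume_hornSet]; exact volume_box_ne_top _ _)

/-- The horn is unbounded. [folklore] -/
theorem not_isBounded_hornSet : ¬ Bornology.IsBounded hornSet := by
  intro h
  obtain ⟨C, hC⟩ := isBounded_iff_forall_norm_le.mp h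
  set t : ℝ := max C 1 + 1 with ht
  have ht1 : 1 < t := by have := le_max_right C 1; linarith
  have htC : C < t := by have := le_max_left C 1; linarith
  have ht0 : 0 < t := by linarith
  have hmem : (![t, (2 * t ^ 2)⁻¹] : Fin 2 → ℝ) ∈ hornSet := by
    refine ⟨by simpa using ht1, by simp; positivity, ?_⟩
    have : t ^ 2 * (2 * t ^ 2)⁻¹ = 1 / 2 := by field_simp
    simp only [Matrix.cons_val_zero, Matrix.cons_val_one, this]
    norm_num
  have hle := (norm_le_pi_norm (![t, (2 * t ^ 2)⁻¹] : Fin 2 → ℝ) 0).trans (hC _ hmem)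
  simp only [Matrix.cons_val_zero, Real.norm_eq_abs, abs_of_pos ht0] at hle
  linarith

/-- The open unit square is bounded. [folklore] -/
theorem isBounded_openUnitSquare : Bornology.IsBounded openUnitSquare.domain :=
  isCompact_Icc.isBounded.subset (box_subset_Icc _ _)

/-- **BOUNDEDNESS IS NOT A ONE-MOVE INVARIANT (calibration).** The unbounded horn
`{x > 1, 0 < y < 1/x²}` and the open unit square differ by ONE change-of-variables move, the
compactification `Φ(x, y) = (1/x, x²y)` (rational over ℚ, injective, `det DΦ = −1`). Contrast §3:
compactness and preconnectedness ARE one-move invariants (continuity of the move map on its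
source). So "bounded vs unbounded" offers a disprover nothing, not even at chain length one. [folklore] -/
theorem horn_sub_openUnitSquare_mem_changeOfVariablesRel :
    KZ.of hornRep - KZ.of openUnitSquare ∈ KZ.changeOfVariablesRel :=
  ⟨2, hornRep, openUnitSquare, hornMap, hornMapDeriv, isSemialgebraicMapOn_hornMap,
    fun p hp => (hasFDerivAt_hornMap (ne_zero_of_mem_hornSet hp)).hasFDerivWithinAt, injOn_hornMap,
    image_hornMap_hornSet.symm,
    fun p hp => by simp [hornRep, det_hornMapDeriv (ne_zero_of_mem_hornSet hp)], rfl⟩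

/-- Hence the horn and the square are congruent in the planar set-chain group. [folklore] -/
theorem horn_sub_openUnitSquare_mem_planarGroup :
    KZ.of hornRep - KZ.of openUnitSquare ∈ planarGroup :=
  AddSubgroup.subset_closure ⟨Or.inr horn_sub_openUnitSquare_mem_changeOfVariablesRel,
    (AddSubgroup.closure planarGens).sub_mem (AddSubgroup.subset_closure ⟨_, fun _ _ => rfl, rfl⟩)
      (AddSubgroup.subset_closure ⟨_, fun _ _ => rfl, rfl⟩)⟩

/-! ## §9 The one-move statement HOLDS on rational boxes -/

section Boxes

variable (l u l' u' : Fin 2 → ℚ)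

/-- The ratio of side lengths in direction `i`. [folklore] -/
def boxRatio (i : Fin 2) : ℚ := (u' i - l' i) / (u i - l i)

/-- The affine diagonal map carrying the box `∏ (lᵢ, uᵢ)` onto `∏ (l'ᵢ, u'ᵢ)`. [folklore] -/
def boxMap : (Fin 2 → ℝ) → (Fin 2 → ℝ) := fun p i =>
  (l' i : ℝ) + (boxRatio l u l' u' i : ℝ) * (p i - l i)

/-- Its (constant) derivative `diag(s₀, s₁)`. [folklore] -/
def boxMapDeriv : (Fin 2 → ℝ) →L[ℝ] (Fin 2 → ℝ) :=
  ContinuousLinearMap.pi fun i => (boxRatio l u l' u' i : ℝ) • pr i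

/-- Auxiliary: `boxMapDeriv_apply`. [folklore] -/
theorem boxMapDeriv_apply (v : Fin 2 → ℝ) (i : Fin 2) :
    boxMapDeriv l u l' u' v i = (boxRatio l u l' u' i : ℝ) * v i := by
  simp [boxMapDeriv]

/-- Auxiliary: `hasFDerivAt_boxMap`. [folklore] -/
theorem hasFDerivAt_boxMap (p : Fin 2 → ℝ) :
    HasFDerivAt (boxMap l u l' u') (boxMapDeriv l u l' u') p := by
  unfold boxMap boxMapDeriv
  exact hasFDerivAt_pi.mpr fun i =>
    ((((pr i).hasFDerivAt (x := p)).sub_const (l i : ℝ)).const_mul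
      (boxRatio l u l' u' i : ℝ)).const_add (l' i : ℝ)

/-- Auxiliary: `det_boxMapDeriv`. [folklore] -/
theorem det_boxMapDeriv :
    (boxMapDeriv l u l' u').det = (boxRatio l u l' u' 0 : ℝ) * (boxRatio l u l' u' 1 : ℝ) := by
  have h : (boxMapDeriv l u l' u' : (Fin 2 → ℝ) →ₗ[ℝ] (Fin 2 → ℝ)) =
      Matrix.toLin' !![(boxRatio l u l' u' 0 : ℝ), 0; 0, (boxRatio l u l' u' 1 : ℝ)] := by
    apply LinearMap.ext
    intro v
    rw [ContinuousLinearMap.coe_coe, Matrix.toLin'_apply]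
    ext i
    fin_cases i <;> simp [boxMapDeriv_apply, Matrix.mulVec, dotProduct, Fin.sum_univ_two]
  rw [ContinuousLinearMap.det, h, LinearMap.det_toLin', Matrix.det_fin_two]
  simp

/-- Auxiliary: `isSemialgebraicMapOn_boxMap`. [folklore] -/
theorem isSemialgebraicMapOn_boxMap {s : Set (Fin 2 → ℝ)} (hs : IsSemialgebraic ℚ s) :
    IsSemialgebraicMapOn ℚ s (boxMap l u l' u') := by
  refine (isSemialgebraicMapOn_aeval hs
    (fun i => C (l' i) + C (boxRatio l u l' u' i) * (X i - C (l i)))).congr fun p _ => ?_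
  ext j
  simp [boxMap]

variable {l u l' u'}

/-- Auxiliary: `boxRatio_pos`. [folklore] -/
theorem boxRatio_pos (hlu : ∀ i, l i < u i) (hlu' : ∀ i, l' i < u' i) (i : Fin 2) :
    0 < boxRatio l u l' u' i :=
  div_pos (sub_pos.mpr (hlu' i)) (sub_pos.mpr (hlu i))

/-- Auxiliary: `boxRatio_mul_sub`. [folklore] -/
theorem boxRatio_mul_sub (hlu : ∀ i, l i < u i) (i : Fin 2) :
    boxRatio l u l' u' i * (u i - l i) = u' i - l' i :=
  div_mul_cancel₀ _ (sub_pos.mpr (hlu i)).ne'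

/-- Equal areas make the diagonal map unimodular: `s₀ s₁ = 1`. [folklore] -/
theorem boxRatio_mul_boxRatio (hlu : ∀ i, l i < u i)
    (harea : (u 0 - l 0) * (u 1 - l 1) = (u' 0 - l' 0) * (u' 1 - l' 1)) :
    boxRatio l u l' u' 0 * boxRatio l u l' u' 1 = 1 := by
  have h0 : (u 0 - l 0) ≠ 0 := (sub_pos.mpr (hlu 0)).ne'
  have h1 : (u 1 - l 1) ≠ 0 := (sub_pos.mpr (hlu 1)).ne'
  unfold boxRatio
  rw [div_mul_div_comm, ← harea, div_self (mul_ne_zero h0 h1)]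

/-- Auxiliary: `injective_boxMap`. [folklore] -/
theorem injective_boxMap (hlu : ∀ i, l i < u i) (hlu' : ∀ i, l' i < u' i) :
    Function.Injective (boxMap l u l' u') := by
  intro p q h
  ext i
  have hi := congrFun h i
  simp only [boxMap, add_right_inj] at hi
  have hs : (boxRatio l u l' u' i : ℝ) ≠ 0 := by exact_mod_cast (boxRatio_pos hlu hlu' i).ne'
  have := mul_left_cancel₀ hs hi
  linarith

/-- Auxiliary: `image_boxMap` — the diagonal map carries the first box onto the second. [folklore] -/
theorem image_boxMap (hlu : ∀ i, l i < u i) (hlu' : ∀ i, l' i < u' i) :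
    boxMap l u l' u' '' (boxRep l u).domain = (boxRep l' u').domain := by
  have hs : ∀ i, (0 : ℝ) < boxRatio l u l' u' i := fun i => by exact_mod_cast boxRatio_pos hlu hlu' i
  have hsu : ∀ i, (boxRatio l u l' u' i : ℝ) * ((u i : ℝ) - l i) = (u' i : ℝ) - l' i := fun i => by
    exact_mod_cast boxRatio_mul_sub (l' := l') (u' := u') hlu i
  ext q
  rw [boxRep_domain, boxRep_domain, mem_box]
  constructor
  · rintro ⟨p, hp, rfl⟩ i
    rw [mem_box] at hp
    obtain ⟨h1, h2⟩ := hp i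
    simp only [boxMap]
    constructor
    · have : 0 < (boxRatio l u l' u' i : ℝ) * (p i - l i) := mul_pos (hs i) (by linarith)
      linarith
    · have : (boxRatio l u l' u' i : ℝ) * (p i - l i) < (boxRatio l u l' u' i : ℝ) * ((u i : ℝ) - l i) :=
        mul_lt_mul_of_pos_left (by linarith) (hs i)
      linarith [hsu i]
  · intro hq
    refine ⟨fun i => (l i : ℝ) + (q i - l' i) / (boxRatio l u l' u' i : ℝ), ?_, ?_⟩
    · rw [mem_box]
      intro i
      obtain ⟨h1, h2⟩ := hq i
      constructor
      · have : 0 < (q i - l' i) / (boxRatio l u l' u' i : ℝ) := div_pos (by linarith) (hs i)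
        linarith
      · have hlt : (q i - l' i) / (boxRatio l u l' u' i : ℝ) < (u i : ℝ) - l i := by
          rw [div_lt_iff₀ (hs i)]
          linarith [hsu i, mul_comm ((u i : ℝ) - l i) (boxRatio l u l' u' i : ℝ)]
        linarith
    · ext i
      have hsi : (boxRatio l u l' u' i : ℝ) ≠ 0 := (hs i).ne'
      simp only [boxMap]
      field_simp
      ring

/-- **THE ONE-MOVE STATEMENT HOLDS ON RATIONAL BOXES (positive boundary of §3).** Any two open
boxes with rational corners and the same area differ by ONE change-of-variables move, the affine
diagonal map `p ↦ l' + diag(s₀, s₁)(p − l)` with `s₀ s₁ = 1` forced by the areas. So the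
refuted strengthening `PlanarOneMove` (§3, killed by `[0,1]²` vs `(0,1)²`) fails only through
boundary / topology, never through shape or position, and the crux holds with chain length one
on this sub-family. [folklore] -/
theorem boxRep_sub_boxRep_mem_changeOfVariablesRel (hlu : ∀ i, l i < u i) (hlu' : ∀ i, l' i < u' i)
    (harea : (u 0 - l 0) * (u 1 - l 1) = (u' 0 - l' 0) * (u' 1 - l' 1)) :
    KZ.of (boxRep l u) - KZ.of (boxRep l' u') ∈ KZ.changeOfVariablesRel := by
  have hdet : (boxMapDeriv l u l' u').det = 1 := by
    rw [det_boxMapDeriv]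
    exact_mod_cast boxRatio_mul_boxRatio (l' := l') (u' := u') hlu harea
  exact ⟨2, boxRep l u, boxRep l' u', boxMap l u l' u', fun _ => boxMapDeriv l u l' u',
    isSemialgebraicMapOn_boxMap l u l' u' (boxRep l u).isSemialgebraic_domain,
    fun p _ => (hasFDerivAt_boxMap l u l' u' p).hasFDerivWithinAt,
    (injective_boxMap hlu hlu').injOn, (image_boxMap hlu hlu').symm,
    fun p _ => by simp [hdet], rfl⟩

/-- Hence any two rational boxes of equal area are congruent in the planar set-chain group. [folklore] -/
theorem boxRep_sub_boxRep_mem_planarGroup (hlu : ∀ i, l i < u i) (hlu' : ∀ i, l' i < u' i)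
    (harea : (u 0 - l 0) * (u 1 - l 1) = (u' 0 - l' 0) * (u' 1 - l' 1)) :
    KZ.of (boxRep l u) - KZ.of (boxRep l' u') ∈ planarGroup :=
  AddSubgroup.subset_closure ⟨Or.inr (boxRep_sub_boxRep_mem_changeOfVariablesRel hlu hlu' harea),
    (AddSubgroup.closure planarGens).sub_mem (AddSubgroup.subset_closure ⟨_, fun _ _ => rfl, rfl⟩)
      (AddSubgroup.subset_closure ⟨_, fun _ _ => rfl, rfl⟩)⟩

end Boxes

/-! ## §4 Why the crux resists (obstruction analysis; prose only, nothing asserted) -/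

/-- WHY IT RESISTS — register for ideators / planners / the lead (cycle 1). An additive invariant `h`
refuting the crux must be defined on planar ℚ-regions of finite area and satisfy:
(i) `h` factors through the Lebesgue class of the domain (§1: null sets are `0`, cuts along any
ℚ-semialgebraic curve are free); (ii) `h` is additive under a.e.-disjoint finite unions;
(iii) `h(Φ(D)) = h(D)` for every ℚ-semialgebraic `Φ` injective on `D`, differentiable within `D` at
each point with `|det| = 1` — on the interior these are exactly the Nash symplectic (or anti-symplectic)
open embeddings, off a nowhere-dense set. REGIMES TRIED, all consistent with the crux:
unbounded regions (`(x,y) ↦ (1/x, x²y)` maps `{x>1, 0<y<x⁻²}` onto `(0,1)²`, |det| = 1); cusps and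
vertical tangencies (`(x,y) ↦ (x³/3, y/x²)` opens `{0<y<x²}`; in general the shear `(φ, y/φ′)` flattens
the subgraph of any Nash `φ′` with SEMIALGEBRAIC primitive `φ` — the only place transcendence enters is
the primitive); components / Euler characteristic / compactness (die by (i)); orientation (|det| allows
reversal); aspect ratio and position (`diag(2,1/2)`, rational translations, rotations with algebraic
entries are single moves); Galois / other real closed fields (a chain is a first-order ℚ-sentence, so
by model completeness it may be taken inside the real algebraic numbers — this confirms ℚ̄-rigidity but
yields no invariant: real closed fields have no automorphisms); the formal 1-motive class of the area
(`area(S) = ∮_∂S x dy`, a curve-type 1-period; cutting adds arcs traversed twice, a symplectic Nash map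
changes `x dy` by a closed algebraic 1-form) — by Huber–Wüstholz Thm 13.3 the formal class carries NO
information beyond the number, so an obstruction can only come from the REALISATION side (a motivic
relation — isogeny / CM correspondence / residue identity among real ovals — with no planar chain),
i.e. exactly the content of the sibling cruxes `PlanarCompiler` ∧ `RealOnePeriodRelations`; proving
non-realisability would itself need an invariant with (i)–(iii). UNTESTED FORMAL VARIANT (information):
if rule 1a were restricted to DISJOINT unions, the o-minimal Euler characteristic (additive on disjoint
definable unions, invariant under ALL definable bijections) would separate `(0,1)²` from
`(0,1)² ∖ {(½,½)}` (equal area, χ = 1 vs 0): the measure-zero-overlap clause of `KZ.domainAddRel` is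
load-bearing for the crux (not formalised: no o-minimal χ in the tree). LITERATURE: CressonViusos2022
(arXiv:1912.01751) Problem 2.1 / Rem 2.3 ask for such an invariant ("Dehn-type") and have none;
DubinsHirschKarush1963 forbids the isometric version only; `ledger negatives` has nothing planar beyond
the empty-body kinematic refutation.

CALIBRATIONS DONE ON PAPER (cycle 1b). (α) The route's CHEAPEST FALSIFIER (1) — Landen/Gauss at
`k = 3/5` (`k' = 4/5`, `k₁ = (1−k')/(1+k') = 1/9`, `K(1/9) = (9/10)·K(3/5)`) — PASSES: with
`S_k = {0<x<1, 0<y, y²(1−x²)(1−k²x²) < 1}` (area `K(k)`) and Landen's map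
`ψ(x) = (1+k')·x·√(1−x²)/√(1−k²x²)` (2-to-1 from `(0,1)` onto `(0,1)`, critical point
`x* = (1+k')^{-1/2}`, pointwise identity `f_{k₁}(ψ x)·|ψ′ x| = (1+k')·f_k(x)`), the chain is: cut `S_k`
at `x = x*` (1a, null segment); on each monotonicity cell the FiniteMapShear `(x,y) ↦ (ψ x, y/|ψ′ x|)`
(ψ, ψ′ semialgebraic, C² on the open cells, |det| = 1) carries the cell onto
`diag(1, 1/(1+k'))·S_{k₁}`; the two copies are merged by a rational translation + StackingShear
(cut along the graph, shear `(x, y − g x)`) into `diag(1, 2/(1+k'))·S_{k₁} = diag(1, 10/9)·S_{1/9}`.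
Six moves, no subtraction, every intermediate set planar with integrand 1. So the 2-isogeny sector
is consistent with the crux. (β) Legendre duplication `B(a,a) = 2^{1−2a} B(½,a)` likewise passes
(substitutions `x = (1+u)/2`, `u = √t`, symmetry = 1a). (γ) THE ACID TEST left for cycle 2+ (and for
ideators): the Fermat-ninth relation `B(5/9,7/9) = (8/3)·3^{1/6}·sin(π/9)·B(5/9,8/9)` (= Gauss
TRIPLICATION at `z = 1/9` + reflection; route FermatIsogeny's IsogenyLinearNinth, stmt-3896): both
sides are areas of planar ℚ-sets (`y⁹x⁴(1−x)² < 1`, resp. `y⁹x⁴(1−x) < c⁹`), the classical proofs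
go through PRODUCTS of integrals (other dimensions, forbidden here), and Huber–Wüstholz only promise
a correspondence on `J(F₉)` not induced by `Aut(F₉)`. A planar chain for (γ) would strongly support
the crux; a structural reason why real substitutions + stacking cannot produce it would be the first
candidate for an invariant finer than area. [folklore] -/
def whyItResists : Prop := True

/-- WHY IT RESISTS, cycle 2 (gen-2 disprover; paper analyses, nothing asserted). Six new attack lines,
all consistent with the crux.

(1) TORSION. `M := closure planarGens ⧸ planarGroup` is a ℤ-module; a counterexample could a priori be a
torsion class (`n([r] − [r′]) ∈ planarGroup` but not `[r] − [r′]`). It cannot: for real algebraic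
`λ > 0` the map `T_λ = diag(1, λ)` sends planar sets to planar sets, 1a-instances to 1a-instances and
conjugates rule-2 instances to rule-2 instances (`T_λ Φ T_λ⁻¹`, still ℚ-semialgebraic, `|det| = 1`), so
it acts on `M`; `[T_{m+n} D] = [T_m D] + [T_n D]` for cells by `StackingShear` (cut along a graph, shear
down), hence `[T_n D] = n[D]`, and `n·x ∈ planarGroup ⇒ T_n x ∈ planarGroup ⇒ x = T_{1/n} T_n x ∈
planarGroup`. So `M` is torsion-free and uniquely divisible — a `(ℚ̄ ∩ ℝ)`-vector space, as the route's
`StackingShear` docstring wants. (Not formalised: needs the functorial action of `T_λ` on `FreeAbelianGroup`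
and the general stacking lemma; no obstruction expected.)

(2) ORIENTATION (§7, formal for the chiral parabola pair): for any subgraph cell
`D = {a<x<b, 0<y<h(x)}` (`h` Nash on `(a,b)`) the composite of the rotation `(x,y) ↦ (a+b−x, H−y)` and the
shear `(u,v) ↦ (u, v − H + h(a+b−u))`, i.e. `(x,y) ↦ (a+b−x, h(x) − y)`, is ℚ-semialgebraic, Nash on
`D`, has `det = +1` and carries `D` onto its mirror image `{a<x<b, 0<y<h(a+b−x)}`. So restricting rule 2
to `det = +1` changes nothing on cells; chirality counts are no invariant.

(3) ONE-MOVE GEOGRAPHY (§8, §9 formal): compactness and preconnectedness are one-move invariants (§3),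
boundedness is NOT (the compactification `(1/x, x²y)` is one move), and on rational boxes one move always
suffices. So the only one-move obstructions found are point-set-topological, all erased by one cut.

(4) SOFTNESS WITHOUT ARITHMETIC ON THE MAPS. If rule 2 admitted arbitrary `C¹` area-preserving injections
(domains still ℚ-semialgebraic), the statement would be TRUE: normalise both sets to finitely many bounded
open cells (discs); refine so that the two lists of cell areas agree termwise — possible with ℚ-semialgebraic
cuts because a cell `{0<y<h}` of area `α` contains, for every `β < α` that is the area of another bounded
cell `{0<y<k}`, a ℚ-semialgebraic sub-cell of area exactly `β` (sketch: transport `k` under `h` by a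
piecewise-LINEAR rational reparametrisation chosen with slack, using `∫(h−k)⁺ > ∫(k−h)⁺`; this fitting
lemma is the one point needing care); then Moser–Dacorogna / Greene–Shiohama give area-preserving
diffeomorphisms between equal-area open discs. Hence ALL the content of the crux is
that the Moser diffeomorphisms can be taken piecewise NASH OVER ℚ̄ — an arithmetic rigidity/flexibility
question with no measure-theoretic shadow. Conversely keeping Nash maps but allowing ONE real parameter in
the domains makes it false (Tarski–Seidenberg interval argument of the route thesis).

(5) AFFINE IS NOT ENOUGH. Restrict rule 2 to unimodular AFFINE maps (algebraic entries), keep curved cuts: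
then the signed equi-affine length `I(D) = Σ_arcs ±∫ κ^{1/3} ds` over the curved arcs of the essential
boundary of the open regularisation of `D` (sign = region on the convex side or not) is additive (a curved
cut contributes the same arc twice with opposite signs; segments contribute `0`), equi-affine invariant, `0`
on polygons and `≠ 0` on `{0<x<1, 0<y<3x²}` (area `1`): a genuine Dehn-type invariant for the AFFINE
sub-pseudogroup. It dies under the first non-affine Nash map (`(x,y) ↦ (x, y − 3x²)`-type shears flatten
the parabola), so non-affine maps are load-bearing — consistent with the route, and it explains why every
invariant candidate must see through all Nash symplectic maps at once.

(6) THE ACID TEST (γ) REVISITED. `B(5/9,7/9) = (8/3)·3^{1/6}·sin(π/9)·B(5/9,8/9)` (Gauss triplication at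
`z = 1/9` + reflection; both sides `9∫₀¹ u⁴v^{−2}du`, `9c∫₀¹u⁴v^{−1}du` on the real arc of `F₉ : u⁹+v⁹=1`).
The eigenforms `ω_{5,7}`, `ω_{5,8}` belong to the simple CM factors `A_{[5,7,6]}`, `A_{[5,8,5]}` of `J(F₉)`
(orbits under `(ℤ/9)^×`: `{(5,7,6),(1,5,3),(2,1,6),(7,8,3),(8,4,6),(4,2,3)}` and
`{(5,8,5),(1,7,1),(2,5,2),(7,4,7),(8,2,8),(4,1,4)}` — DIFFERENT factors, so no automorphism of `F₉` relates
them, as the route says), and both factors have Koblitz–Rohrlich CM type `{h : ⟨hr⟩+⟨hs⟩+⟨ht⟩ = 9} = {2,4,8}`.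
Same CM field `ℚ(ζ₉)` and same CM type ⇒ the factors are ISOGENOUS over ℚ̄; complex conjugation acts
semilinearly on the 1-dimensional `ℚ(ζ₉)`-space `Hom⁰(A₁, A₂)`, so by Hilbert 90 an isogeny defined over a
REAL number field exists. Hence the relation is an honest instance of HW functoriality along a real
correspondence `F₉ ← Z → F₉`, i.e. exactly what `CurvePeriodsTransfer` + `PlanarCompiler` claim to compile;
nothing in (γ) distinguishes it structurally from the Landen calibration (α) except size. A planar chain is
still not known explicitly (the correspondence `Z` has not been written down); producing it is prover work
(route FermatIsogeny, stmt-3896), and its impossibility could only be shown by an invariant as in §6.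

LITERATURE (cycle 2): `lit search` was unavailable (searchd rc 75) during this cycle; the print sweep for
a curved-scissors / Nash-symplectic equidecomposition invariant therefore still rests on the route's and
the reviewers' records (CressonViusos2022 Problem 2.1 open; DubinsHirschKarush1963 isometric only;
Kuperberg-type symplectic packing results concern embeddings of FIXED shapes, not cut-and-paste). [folklore] -/
def whyItResists2 : Prop := True

/-! ## §10 The semicubical cusp cell, the quartic cell, and the two rational moves -/

/-- The semicubical cusp cell `C = {0 < x < 1, 0 < y, y² < x³}` (the subgraph of `x^{3/2}`, area `2/5`);
its closure carries the singular half-branch `y = x^{3/2}` at the origin. [folklore] -/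
def cuspSet : Set (Fin 2 → ℝ) := {p | 0 < p 0 ∧ p 0 < 1 ∧ 0 < p 1 ∧ p 1 ^ 2 < p 0 ^ 3}

/-- The quartic cell `B = {0 < t < 1, 0 < y < 2t⁴}` (area `2/5`, smooth boundary arcs). [folklore] -/
def quarticSet : Set (Fin 2 → ℝ) := {p | 0 < p 0 ∧ p 0 < 1 ∧ 0 < p 1 ∧ p 1 < 2 * p 0 ^ 4}

/-- Auxiliary: `isSemialgebraic_cuspSet`. [folklore] -/
theorem isSemialgebraic_cuspSet : IsSemialgebraic ℚ cuspSet := by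
  have h := (((isSemialgebraic_setOf_eval_lt (k := ℚ) (R := ℝ) (ι := Fin 2) (C 0) (X 0)).inter
    (isSemialgebraic_setOf_eval_lt (k := ℚ) (R := ℝ) (ι := Fin 2) (X 0) (C 1))).inter
    (isSemialgebraic_setOf_eval_lt (k := ℚ) (R := ℝ) (ι := Fin 2) (C 0) (X 1))).inter
    (isSemialgebraic_setOf_eval_lt (k := ℚ) (R := ℝ) (ι := Fin 2) (X 1 ^ 2) (X 0 ^ 3))
  have hEq : cuspSet =
      (({x : Fin 2 → ℝ | aeval x (C 0 : MvPolynomial (Fin 2) ℚ) < aeval x (X 0 : MvPolynomial (Fin 2) ℚ)} ∩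
      {x : Fin 2 → ℝ | aeval x (X 0 : MvPolynomial (Fin 2) ℚ) < aeval x (C 1 : MvPolynomial (Fin 2) ℚ)}) ∩
      {x : Fin 2 → ℝ | aeval x (C 0 : MvPolynomial (Fin 2) ℚ) < aeval x (X 1 : MvPolynomial (Fin 2) ℚ)}) ∩
      {x : Fin 2 → ℝ | aeval x (X 1 ^ 2 : MvPolynomial (Fin 2) ℚ) < aeval x (X 0 ^ 3 : MvPolynomial (Fin 2) ℚ)} := by
    ext p
    simp [cuspSet, and_assoc]
  rw [hEq]; exact h

/-- Auxiliary: `isSemialgebraic_quarticSet`. [folklore] -/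
theorem isSemialgebraic_quarticSet : IsSemialgebraic ℚ quarticSet := by
  have h := (((isSemialgebraic_setOf_eval_lt (k := ℚ) (R := ℝ) (ι := Fin 2) (C 0) (X 0)).inter
    (isSemialgebraic_setOf_eval_lt (k := ℚ) (R := ℝ) (ι := Fin 2) (X 0) (C 1))).inter
    (isSemialgebraic_setOf_eval_lt (k := ℚ) (R := ℝ) (ι := Fin 2) (C 0) (X 1))).inter
    (isSemialgebraic_setOf_eval_lt (k := ℚ) (R := ℝ) (ι := Fin 2) (X 1) (C 2 * X 0 ^ 4))
  have hEq : quarticSet =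
      (({x : Fin 2 → ℝ | aeval x (C 0 : MvPolynomial (Fin 2) ℚ) < aeval x (X 0 : MvPolynomial (Fin 2) ℚ)} ∩
      {x : Fin 2 → ℝ | aeval x (X 0 : MvPolynomial (Fin 2) ℚ) < aeval x (C 1 : MvPolynomial (Fin 2) ℚ)}) ∩
      {x : Fin 2 → ℝ | aeval x (C 0 : MvPolynomial (Fin 2) ℚ) < aeval x (X 1 : MvPolynomial (Fin 2) ℚ)}) ∩
      {x : Fin 2 → ℝ | aeval x (X 1 : MvPolynomial (Fin 2) ℚ) <
        aeval x (C 2 * X 0 ^ 4 : MvPolynomial (Fin 2) ℚ)} := by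
    ext p
    simp [quarticSet, and_assoc]
  rw [hEq]; exact h

/-- Both cells lie in the unit square `[0,1]²`. [folklore] -/
theorem cuspSet_subset_Icc : cuspSet ⊆ Icc (0 : Fin 2 → ℝ) 1 := by
  rintro p ⟨h0, h1, h2, h3⟩
  have hx3 : p 0 ^ 3 < 1 := pow_lt_one₀ h0.le h1 (by norm_num)
  have hy2 : p 1 ^ 2 < 1 := h3.trans hx3
  have hy : p 1 < 1 := lt_of_pow_lt_pow_left₀ 2 zero_le_one (by simpa using hy2)
  refine ⟨fun i => ?_, fun i => ?_⟩ <;> fin_cases i <;> simp <;> linarith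

/-- Auxiliary: `quarticSet_subset_Icc2`. [folklore] -/
theorem quarticSet_subset_Icc : quarticSet ⊆ Icc (0 : Fin 2 → ℝ) ![1, 2] := by
  rintro p ⟨h0, h1, h2, h3⟩
  have hx4 : p 0 ^ 4 < 1 := pow_lt_one₀ h0.le h1 (by norm_num)
  refine ⟨fun i => ?_, fun i => ?_⟩ <;> fin_cases i <;> simp <;> linarith

/-- Auxiliary: `volume_cuspBox_lt_top`. [folklore] -/
theorem volume_Icc_one_lt_top : volume (Icc (0 : Fin 2 → ℝ) 1) < ⊤ := isCompact_Icc.measure_lt_top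

/-- Auxiliary: `volume_Icc_two_lt_top`. [folklore] -/
theorem volume_Icc_two_lt_top : volume (Icc (0 : Fin 2 → ℝ) ![1, 2]) < ⊤ := isCompact_Icc.measure_lt_top

/-- The semicubical cusp cell as a planar set. [folklore] -/
def cuspRep : KZ.IntegralRep 2 where
  domain := cuspSet
  integrand := fun _ => 1
  isSemialgebraic_domain := isSemialgebraic_cuspSet
  isSemialgebraicFunOn_integrand := isSemialgebraicFunOn_one isSemialgebraic_cuspSet
  integrableOn := integrableOn_const
    ((measure_mono cuspSet_subset_Icc).trans_lt volume_Icc_one_lt_top).ne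

/-- The quartic cell as a planar set. [folklore] -/
def quarticRep : KZ.IntegralRep 2 where
  domain := quarticSet
  integrand := fun _ => 1
  isSemialgebraic_domain := isSemialgebraic_quarticSet
  isSemialgebraicFunOn_integrand := isSemialgebraicFunOn_one isSemialgebraic_quarticSet
  integrableOn := integrableOn_const
    ((measure_mono quarticSet_subset_Icc).trans_lt volume_Icc_two_lt_top).ne

/-- First coordinate is non-zero on the quartic cell. [folklore] -/
theorem ne_zero_of_mem_quarticSet {p : Fin 2 → ℝ} (hp : p ∈ quarticSet) : p 0 ≠ 0 := hp.1.ne'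

/-! ### Move 1: the blow-up `cuspMap (t, y) = (t², y / (2t))` from the quartic cell onto the cusp cell -/

/-- The blow-up map `(t, y) ↦ (t², y/(2t))` (`det = 1`; NOT `C¹` up to the origin). [folklore] -/
def cuspMap : (Fin 2 → ℝ) → (Fin 2 → ℝ) := fun p => ![p 0 ^ 2, p 1 * (p 0)⁻¹ * 2⁻¹]

/-- Its derivative at `p`: `v ↦ (2t v₀, −y v₀/(2t²) + v₁/(2t))`. [folklore] -/
def cuspMapDeriv (p : Fin 2 → ℝ) : (Fin 2 → ℝ) →L[ℝ] (Fin 2 → ℝ) :=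
  ContinuousLinearMap.pi ![(2 * p 0) • pr 0, (-(p 1 * (p 0 ^ 2)⁻¹ * 2⁻¹)) • pr 0 + ((p 0)⁻¹ * 2⁻¹) • pr 1]

/-- Auxiliary: `cuspMapDeriv_apply`. [folklore] -/
theorem cuspMapDeriv_apply (p v : Fin 2 → ℝ) :
    cuspMapDeriv p v = ![2 * p 0 * v 0, -(p 1 * (p 0 ^ 2)⁻¹ * 2⁻¹) * v 0 + (p 0)⁻¹ * 2⁻¹ * v 1] := by
  ext i
  fin_cases i <;> simp [cuspMapDeriv]

/-- Auxiliary: `hasFDerivAt_inv_coord` — derivative of `q ↦ (q 0)⁻¹`. [folklore] -/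
theorem hasFDerivAt_inv_coord {p : Fin 2 → ℝ} (hp : p 0 ≠ 0) :
    HasFDerivAt (fun q : Fin 2 → ℝ => (q 0)⁻¹) (-(p 0 ^ 2)⁻¹ • pr 0) p := by
  have h := (hasFDerivAt_inv (𝕜 := ℝ) hp).comp p ((pr 0).hasFDerivAt (x := p))
  refine h.congr_fderiv ?_
  ext v
  simp [ContinuousLinearMap.toSpanSingleton_apply, mul_comm]

/-- Auxiliary: `hasFDerivAt_cuspMap_fst`. [folklore] -/
theorem hasFDerivAt_cuspMap_fst (p : Fin 2 → ℝ) :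
    HasFDerivAt (fun q : Fin 2 → ℝ => q 0 ^ 2) ((2 * p 0) • pr 0) p := by
  have h := ((pr 0).hasFDerivAt (x := p)).pow 2
  refine h.congr_fderiv ?_
  ext v
  simp [two_mul]

/-- Auxiliary: `hasFDerivAt_cuspMap_snd`. [folklore] -/
theorem hasFDerivAt_cuspMap_snd {p : Fin 2 → ℝ} (hp : p 0 ≠ 0) :
    HasFDerivAt (fun q : Fin 2 → ℝ => q 1 * (q 0)⁻¹ * 2⁻¹)
      ((-(p 1 * (p 0 ^ 2)⁻¹ * 2⁻¹)) • pr 0 + ((p 0)⁻¹ * 2⁻¹) • pr 1) p := by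
  have h := (((pr 1).hasFDerivAt (x := p)).mul (hasFDerivAt_inv_coord hp)).mul_const (2⁻¹ : ℝ)
  refine h.congr_fderiv ?_
  ext v
  simp
  ring

/-- Auxiliary: `hasFDerivAt_cuspMap`. [folklore] -/
theorem hasFDerivAt_cuspMap {p : Fin 2 → ℝ} (hp : p 0 ≠ 0) : HasFDerivAt cuspMap (cuspMapDeriv p) p := by
  rw [hasFDerivAt_pi']
  refine Fin.forall_fin_two.mpr ⟨?_, ?_⟩
  · have e : (2 * p 0) • pr 0 = (pr 0).comp (cuspMapDeriv p) := by
      ext v; simp [cuspMapDeriv]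
    exact (hasFDerivAt_cuspMap_fst p).congr_fderiv e
  · have e : (-(p 1 * (p 0 ^ 2)⁻¹ * 2⁻¹)) • pr 0 + ((p 0)⁻¹ * 2⁻¹) • pr 1 =
        (pr 1).comp (cuspMapDeriv p) := by
      ext v; simp [cuspMapDeriv]
    exact (hasFDerivAt_cuspMap_snd hp).congr_fderiv e

/-- Auxiliary: `det_cuspMapDeriv` — the blow-up is area-preserving. [folklore] -/
theorem det_cuspMapDeriv {p : Fin 2 → ℝ} (hp : p 0 ≠ 0) : (cuspMapDeriv p).det = 1 := by
  have h : (cuspMapDeriv p : (Fin 2 → ℝ) →ₗ[ℝ] (Fin 2 → ℝ)) =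
      Matrix.toLin' !![2 * p 0, 0; -(p 1 * (p 0 ^ 2)⁻¹ * 2⁻¹), (p 0)⁻¹ * 2⁻¹] := by
    apply LinearMap.ext
    intro v
    rw [ContinuousLinearMap.coe_coe, cuspMapDeriv_apply, Matrix.toLin'_apply]
    ext i
    fin_cases i <;> simp [Matrix.mulVec, dotProduct, Fin.sum_univ_two]
  rw [ContinuousLinearMap.det, h, LinearMap.det_toLin', Matrix.det_fin_two]
  simp
  field_simp

/-- Auxiliary: `isSemialgebraicMapOn_cuspMap` (a rational map over `ℚ`). [folklore] -/
theorem isSemialgebraicMapOn_cuspMap : IsSemialgebraicMapOn ℚ quarticSet cuspMap := by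
  refine IsSemialgebraicMapOn.of_forall isSemialgebraic_quarticSet (Fin.forall_fin_two.mpr ⟨?_, ?_⟩)
  · exact (isSemialgebraicFunOn_aeval isSemialgebraic_quarticSet (X 0 ^ 2)).congr
      fun x _ => by simp [cuspMap]
  · refine (isSemialgebraicFunOn_aeval_div_aeval isSemialgebraic_quarticSet (X 1) (C 2 * X 0) ?_).congr ?_
    · intro x hx
      have h1 : 0 < x 0 := hx.1
      simp only [map_mul, aeval_C, aeval_X, ne_eq, mul_eq_zero, not_or]
      exact ⟨by norm_num, h1.ne'⟩
    · intro x _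
      simp [cuspMap]
      ring

/-- Auxiliary: `injOn_cuspMap`. [folklore] -/
theorem injOn_cuspMap : InjOn cuspMap quarticSet := by
  intro p hp q hq h
  have hp0 : 0 < p 0 := hp.1
  have hq0 : 0 < q 0 := hq.1
  have h0 := congrFun h 0
  have h1 := congrFun h 1
  simp only [cuspMap, Matrix.cons_val_zero, Matrix.cons_val_one] at h0 h1
  have e0 : p 0 = q 0 := by
    have := (pow_left_strictMonoOn₀ two_ne_zero).injOn hp0.le hq0.le h0
    exact this
  rw [e0] at h1
  have e1 : p 1 = q 1 := by
    have hq0' : (q 0)⁻¹ * 2⁻¹ ≠ 0 := by positivity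
    have := mul_right_cancel₀ hq0' (by simpa [mul_assoc] using h1)
    exact this
  ext i
  fin_cases i
  · exact e0
  · exact e1

/-- Auxiliary: `image_cuspMap_quarticSet` — the quartic cell goes onto the cusp cell. [folklore] -/
theorem image_cuspMap_quarticSet : cuspMap '' quarticSet = cuspSet := by
  ext q
  constructor
  · rintro ⟨p, ⟨h0, h1, h2, h3⟩, rfl⟩
    refine ⟨?_, ?_, ?_, ?_⟩
    · simp only [cuspMap, Matrix.cons_val_zero]; positivity
    · simp only [cuspMap, Matrix.cons_val_zero]; nlinarith
    · simp only [cuspMap, Matrix.cons_val_one, Matrix.cons_val_zero]; positivity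
    · simp only [cuspMap, Matrix.cons_val_one, Matrix.cons_val_zero]
      have hp0 : p 0 ≠ 0 := h0.ne'
      have key : (p 1 * (p 0)⁻¹ * 2⁻¹) ^ 2 = p 1 ^ 2 / (4 * p 0 ^ 2) := by
        field_simp
        ring
      rw [key, div_lt_iff₀ (by positivity)]
      have hprod : 0 < (2 * p 0 ^ 4 - p 1) * (2 * p 0 ^ 4 + p 1) := mul_pos (by linarith) (by positivity)
      nlinarith [hprod]
  · rintro ⟨h0, h1, h2, h3⟩
    set s : ℝ := Real.sqrt (q 0) with hs
    have hs0 : 0 < s := Real.sqrt_pos.mpr h0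
    have hs2 : s ^ 2 = q 0 := Real.sq_sqrt h0.le
    have hs1 : s < 1 := by
      rw [hs, Real.sqrt_lt' one_pos]; simpa using h1
    have hys : q 1 < s ^ 3 := by
      refine lt_of_pow_lt_pow_left₀ 2 (by positivity) ?_
      calc q 1 ^ 2 < q 0 ^ 3 := h3
        _ = (s ^ 3) ^ 2 := by rw [← hs2]; ring
    refine ⟨![s, 2 * s * q 1], ⟨?_, ?_, ?_, ?_⟩, ?_⟩
    · simpa using hs0
    · simpa using hs1
    · simp; positivity
    · simp only [Matrix.cons_val_one, Matrix.cons_val_zero]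
      have : 2 * s * q 1 < 2 * s * s ^ 3 := by
        have h2s : 0 < 2 * s := by positivity
        nlinarith
      nlinarith
    · simp only [cuspMap]
      ext i
      fin_cases i
      · simp [hs2]
      · simp
        field_simp

/-- **MOVE 1 (blow-up of the cusp).** `[quartic cell] − [cusp cell]` is ONE change-of-variables
instance via `(t, y) ↦ (t², y/(2t))` — rational over `ℚ`, injective, `det = 1` on the open quartic
cell, and singular at the origin (it does not extend `C¹` to any neighbourhood of the closure). [folklore] -/
theorem quartic_sub_cusp_mem_changeOfVariablesRel :
    KZ.of quarticRep - KZ.of cuspRep ∈ KZ.changeOfVariablesRel :=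
  ⟨2, quarticRep, cuspRep, cuspMap, cuspMapDeriv, isSemialgebraicMapOn_cuspMap,
    fun p hp => (hasFDerivAt_cuspMap (ne_zero_of_mem_quarticSet hp)).hasFDerivWithinAt, injOn_cuspMap,
    image_cuspMap_quarticSet.symm,
    fun p hp => by simp [quarticRep, cuspRep, det_cuspMapDeriv (ne_zero_of_mem_quarticSet hp)], rfl⟩

/-- **THE BLOW-UP MOVE IS NOT TAME.** The derivative of `cuspMap` is unbounded on the quartic cell (at
`(t, t⁴)` it stretches the vertical unit vector by `1/(2t)`), so `cuspMap` — a legitimate rule-2 map, being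
differentiable within the OPEN cell — admits no `C¹` extension to any neighbourhood of the closure of the
cell: it is not a move of any tame sub-calculus (Richter's dissections, Cresson–Viu-Sos's `K₀(𝒞_saq)`).
[folklore] -/
theorem not_exists_bound_norm_cuspMapDeriv : ¬ ∃ L : ℝ, ∀ p ∈ quarticSet, ‖cuspMapDeriv p‖ ≤ L := by
  rintro ⟨L, hL⟩
  set t : ℝ := min (1 / 2) (1 / (2 * (|L| + 1))) with ht
  have hL0 : 0 < |L| + 1 := by positivity
  have ht0 : 0 < t := lt_min (by norm_num) (by positivity)
  have ht1 : t < 1 := (min_le_left _ _).trans_lt (by norm_num)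
  have htL : t ≤ 1 / (2 * (|L| + 1)) := min_le_right _ _
  have hmem : (![t, t ^ 4] : Fin 2 → ℝ) ∈ quarticSet := by
    refine ⟨by simpa using ht0, by simpa using ht1, by simp; positivity, ?_⟩
    simp only [Matrix.cons_val_one, Matrix.cons_val_zero]
    nlinarith [pow_pos ht0 4]
  have h := hL _ hmem
  set A := cuspMapDeriv ![t, t ^ 4] with hA
  set e : Fin 2 → ℝ := ![0, 1] with he
  have hne : ‖e‖ ≤ 1 := by
    rw [pi_norm_le_iff_of_nonneg zero_le_one]
    intro i; fin_cases i <;> simp [he]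
  have h1 : ‖A e‖ ≤ ‖A‖ := (A.le_opNorm e).trans (mul_le_of_le_one_right (norm_nonneg _) hne)
  have hAe : A e = ![0, t⁻¹ * 2⁻¹] := by
    rw [hA, cuspMapDeriv_apply]
    ext i
    fin_cases i <;> simp [he]
  have h2 : t⁻¹ * 2⁻¹ ≤ ‖A e‖ := by
    have := norm_le_pi_norm (A e) 1
    rw [hAe] at this ⊢
    simp only [Matrix.cons_val_one, Matrix.cons_val_zero, Real.norm_eq_abs] at this
    rwa [abs_of_pos (by positivity)] at this
  have h3 : t⁻¹ * 2⁻¹ ≤ L := (h2.trans h1).trans h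
  have h4 : |L| + 1 ≤ t⁻¹ * 2⁻¹ := by
    rw [show t⁻¹ * 2⁻¹ = 1 / (2 * t) by field_simp, le_div_iff₀ (by positivity)]
    calc (|L| + 1) * (2 * t) = 2 * (|L| + 1) * t := by ring
      _ ≤ 2 * (|L| + 1) * (1 / (2 * (|L| + 1))) := by gcongr
      _ = 1 := by field_simp
  linarith [le_abs_self L]

/-! ### Move 2: the flattening `flatMap (t, y) = (t⁵, y / (5t⁴))` from the quartic cell onto a box -/

/-- The flattening map `(t, y) ↦ (t⁵, y/(5t⁴))` (`det = 1`). [folklore] -/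
def flatMap : (Fin 2 → ℝ) → (Fin 2 → ℝ) := fun p => ![p 0 ^ 5, p 1 * (p 0 ^ 4)⁻¹ * 5⁻¹]

/-- Its derivative at `p`: `v ↦ (5t⁴ v₀, −4y v₀/(5t⁵) + v₁/(5t⁴))`. [folklore] -/
def flatMapDeriv (p : Fin 2 → ℝ) : (Fin 2 → ℝ) →L[ℝ] (Fin 2 → ℝ) :=
  ContinuousLinearMap.pi ![(5 * p 0 ^ 4) • pr 0,
    (-(p 1 * (4 * p 0 ^ 3) * ((p 0 ^ 4) ^ 2)⁻¹ * 5⁻¹)) • pr 0 + ((p 0 ^ 4)⁻¹ * 5⁻¹) • pr 1]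

/-- Auxiliary: `flatMapDeriv_apply`. [folklore] -/
theorem flatMapDeriv_apply (p v : Fin 2 → ℝ) :
    flatMapDeriv p v = ![5 * p 0 ^ 4 * v 0,
      -(p 1 * (4 * p 0 ^ 3) * ((p 0 ^ 4) ^ 2)⁻¹ * 5⁻¹) * v 0 + (p 0 ^ 4)⁻¹ * 5⁻¹ * v 1] := by
  ext i
  fin_cases i <;> simp [flatMapDeriv]

/-- Auxiliary: `hasFDerivAt_pow4_coord` — derivative of `q ↦ q 0 ^ 4`. [folklore] -/
theorem hasFDerivAt_pow4_coord (p : Fin 2 → ℝ) :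
    HasFDerivAt (fun q : Fin 2 → ℝ => q 0 ^ 4) ((4 * p 0 ^ 3) • pr 0) p := by
  have h := ((pr 0).hasFDerivAt (x := p)).pow 4
  refine h.congr_fderiv ?_
  ext v
  simp

/-- Auxiliary: `hasFDerivAt_inv_pow4_coord` — derivative of `q ↦ (q 0 ^ 4)⁻¹`. [folklore] -/
theorem hasFDerivAt_inv_pow4_coord {p : Fin 2 → ℝ} (hp : p 0 ≠ 0) :
    HasFDerivAt (fun q : Fin 2 → ℝ => (q 0 ^ 4)⁻¹) ((-((p 0 ^ 4) ^ 2)⁻¹ * (4 * p 0 ^ 3)) • pr 0) p := by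
  have h := (hasFDerivAt_inv (𝕜 := ℝ) (pow_ne_zero 4 hp)).comp p (hasFDerivAt_pow4_coord p)
  refine h.congr_fderiv ?_
  ext v
  simp [ContinuousLinearMap.toSpanSingleton_apply]
  ring

/-- Auxiliary: `hasFDerivAt_flatMap_fst`. [folklore] -/
theorem hasFDerivAt_flatMap_fst (p : Fin 2 → ℝ) :
    HasFDerivAt (fun q : Fin 2 → ℝ => q 0 ^ 5) ((5 * p 0 ^ 4) • pr 0) p := by
  have h := ((pr 0).hasFDerivAt (x := p)).pow 5
  refine h.congr_fderiv ?_
  ext v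
  simp

/-- Auxiliary: `hasFDerivAt_flatMap_snd`. [folklore] -/
theorem hasFDerivAt_flatMap_snd {p : Fin 2 → ℝ} (hp : p 0 ≠ 0) :
    HasFDerivAt (fun q : Fin 2 → ℝ => q 1 * (q 0 ^ 4)⁻¹ * 5⁻¹)
      ((-(p 1 * (4 * p 0 ^ 3) * ((p 0 ^ 4) ^ 2)⁻¹ * 5⁻¹)) • pr 0 + ((p 0 ^ 4)⁻¹ * 5⁻¹) • pr 1) p := by
  have h := (((pr 1).hasFDerivAt (x := p)).mul (hasFDerivAt_inv_pow4_coord hp)).mul_const (5⁻¹ : ℝ)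
  refine h.congr_fderiv ?_
  ext v
  simp
  ring

/-- Auxiliary: `hasFDerivAt_flatMap`. [folklore] -/
theorem hasFDerivAt_flatMap {p : Fin 2 → ℝ} (hp : p 0 ≠ 0) : HasFDerivAt flatMap (flatMapDeriv p) p := by
  rw [hasFDerivAt_pi']
  refine Fin.forall_fin_two.mpr ⟨?_, ?_⟩
  · have e : (5 * p 0 ^ 4) • pr 0 = (pr 0).comp (flatMapDeriv p) := by
      ext v; simp [flatMapDeriv]
    exact (hasFDerivAt_flatMap_fst p).congr_fderiv e
  · have e : (-(p 1 * (4 * p 0 ^ 3) * ((p 0 ^ 4) ^ 2)⁻¹ * 5⁻¹)) • pr 0 + ((p 0 ^ 4)⁻¹ * 5⁻¹) • pr 1 =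
        (pr 1).comp (flatMapDeriv p) := by
      ext v; simp [flatMapDeriv]
    exact (hasFDerivAt_flatMap_snd hp).congr_fderiv e

/-- Auxiliary: `det_flatMapDeriv` — the flattening is area-preserving. [folklore] -/
theorem det_flatMapDeriv {p : Fin 2 → ℝ} (hp : p 0 ≠ 0) : (flatMapDeriv p).det = 1 := by
  have h : (flatMapDeriv p : (Fin 2 → ℝ) →ₗ[ℝ] (Fin 2 → ℝ)) =
      Matrix.toLin' !![5 * p 0 ^ 4, 0;
        -(p 1 * (4 * p 0 ^ 3) * ((p 0 ^ 4) ^ 2)⁻¹ * 5⁻¹), (p 0 ^ 4)⁻¹ * 5⁻¹] := by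
    apply LinearMap.ext
    intro v
    rw [ContinuousLinearMap.coe_coe, flatMapDeriv_apply, Matrix.toLin'_apply]
    ext i
    fin_cases i <;> simp [Matrix.mulVec, dotProduct, Fin.sum_univ_two]
  rw [ContinuousLinearMap.det, h, LinearMap.det_toLin', Matrix.det_fin_two]
  have h4 : p 0 ^ 4 ≠ 0 := pow_ne_zero 4 hp
  simp
  field_simp

/-- Auxiliary: `isSemialgebraicMapOn_flatMap` (a rational map over `ℚ`). [folklore] -/
theorem isSemialgebraicMapOn_flatMap : IsSemialgebraicMapOn ℚ quarticSet flatMap := by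
  refine IsSemialgebraicMapOn.of_forall isSemialgebraic_quarticSet (Fin.forall_fin_two.mpr ⟨?_, ?_⟩)
  · exact (isSemialgebraicFunOn_aeval isSemialgebraic_quarticSet (X 0 ^ 5)).congr
      fun x _ => by simp [flatMap]
  · refine (isSemialgebraicFunOn_aeval_div_aeval isSemialgebraic_quarticSet (X 1) (C 5 * X 0 ^ 4) ?_).congr ?_
    · intro x hx
      have h1 : 0 < x 0 := hx.1
      simp only [map_mul, map_pow, aeval_C, aeval_X, ne_eq, mul_eq_zero, not_or]
      exact ⟨by norm_num, pow_ne_zero 4 h1.ne'⟩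
    · intro x _
      simp [flatMap]
      ring

/-- Auxiliary: `injOn_flatMap`. [folklore] -/
theorem injOn_flatMap : InjOn flatMap quarticSet := by
  intro p hp q hq h
  have hp0 : 0 < p 0 := hp.1
  have hq0 : 0 < q 0 := hq.1
  have h0 := congrFun h 0
  have h1 := congrFun h 1
  simp only [flatMap, Matrix.cons_val_zero, Matrix.cons_val_one] at h0 h1
  have e0 : p 0 = q 0 :=
    (pow_left_strictMonoOn₀ (by norm_num : (5 : ℕ) ≠ 0)).injOn hp0.le hq0.le h0
  rw [e0] at h1
  have e1 : p 1 = q 1 := by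
    have hq0' : (q 0 ^ 4)⁻¹ * 5⁻¹ ≠ 0 := by positivity
    exact mul_right_cancel₀ hq0' (by simpa [mul_assoc] using h1)
  ext i
  fin_cases i
  · exact e0
  · exact e1

/-- The target box `(0,1) × (0,2/5)` as a planar set. [folklore] -/
abbrev cuspBox : KZ.IntegralRep 2 := boxRep ![0, 0] ![1, 2 / 5]

/-- Membership in the target box. [folklore] -/
theorem mem_cuspBox {q : Fin 2 → ℝ} :
    q ∈ cuspBox.domain ↔ (0 < q 0 ∧ q 0 < 1) ∧ (0 < q 1 ∧ q 1 < 2 / 5) := by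
  simp [mem_box, Fin.forall_fin_two]

/-- Auxiliary: `image_flatMap_quarticSet` — the quartic cell goes onto the box `(0,1) × (0,2/5)`. [folklore] -/
theorem image_flatMap_quarticSet : flatMap '' quarticSet = cuspBox.domain := by
  ext q
  rw [mem_cuspBox]
  constructor
  · rintro ⟨p, ⟨h0, h1, h2, h3⟩, rfl⟩
    have h4 : 0 < p 0 ^ 4 := by positivity
    refine ⟨⟨?_, ?_⟩, ?_, ?_⟩
    · simp only [flatMap, Matrix.cons_val_zero]; positivity
    · simp only [flatMap, Matrix.cons_val_zero]; exact pow_lt_one₀ h0.le h1 (by norm_num)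
    · simp only [flatMap, Matrix.cons_val_one, Matrix.cons_val_zero]; positivity
    · simp only [flatMap, Matrix.cons_val_one, Matrix.cons_val_zero]
      rw [show p 1 * (p 0 ^ 4)⁻¹ * 5⁻¹ = p 1 / (5 * p 0 ^ 4) by field_simp,
        div_lt_iff₀ (by positivity)]
      linarith
  · rintro ⟨⟨h0, h1⟩, h2, h3⟩
    set t : ℝ := q 0 ^ ((5 : ℕ)⁻¹ : ℝ) with ht
    have ht0 : 0 < t := Real.rpow_pos_of_pos h0 _
    have ht5 : t ^ 5 = q 0 := Real.rpow_inv_natCast_pow h0.le (by norm_num)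
    have ht1 : t < 1 := Real.rpow_lt_one h0.le h1 (by norm_num)
    have ht4 : 0 < t ^ 4 := by positivity
    refine ⟨![t, 5 * t ^ 4 * q 1], ⟨?_, ?_, ?_, ?_⟩, ?_⟩
    · simpa using ht0
    · simpa using ht1
    · simp; positivity
    · simp only [Matrix.cons_val_one, Matrix.cons_val_zero]
      nlinarith
    · simp only [flatMap]
      ext i
      fin_cases i
      · simp [ht5]
      · simp
        field_simp

/-- **MOVE 2 (flattening the quartic cell).** `[quartic cell] − [(0,1) × (0,2/5)]` is ONE
change-of-variables instance via `(t, y) ↦ (t⁵, y/(5t⁴))` (rational over `ℚ`, `det = 1`). [folklore] -/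
theorem quartic_sub_cuspBox_mem_changeOfVariablesRel :
    KZ.of quarticRep - KZ.of cuspBox ∈ KZ.changeOfVariablesRel :=
  ⟨2, quarticRep, cuspBox, flatMap, flatMapDeriv, isSemialgebraicMapOn_flatMap,
    fun p hp => (hasFDerivAt_flatMap (ne_zero_of_mem_quarticSet hp)).hasFDerivWithinAt, injOn_flatMap,
    image_flatMap_quarticSet.symm,
    fun p hp => by simp [quarticRep, det_flatMapDeriv (ne_zero_of_mem_quarticSet hp)], rfl⟩

/-! ### Conclusion: the cusp cell is congruent to a box in the planar set-chain group -/

/-- Planar rule-2 instances between planar sets lie in the planar set-chain group. [folklore] -/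
theorem mem_planarGroup_of_mem_changeOfVariablesRel {r r' : KZ.IntegralRep 2}
    (hr : ∀ p ∈ r.domain, r.integrand p = 1) (hr' : ∀ p ∈ r'.domain, r'.integrand p = 1)
    (h : KZ.of r - KZ.of r' ∈ KZ.changeOfVariablesRel) : KZ.of r - KZ.of r' ∈ planarGroup :=
  AddSubgroup.subset_closure ⟨Or.inr h,
    (AddSubgroup.closure planarGens).sub_mem (AddSubgroup.subset_closure ⟨r, hr, rfl⟩)
      (AddSubgroup.subset_closure ⟨r', hr', rfl⟩)⟩

/-- **SINGULAR BOUNDARY BRANCHES ARE NO INVARIANT (calibration; tameness is load-bearing in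
reverse).** The semicubical cusp cell `{0 < x < 1, 0 < y, y² < x³}` and the box `(0,1) × (0,2/5)` are
congruent in the planar set-chain group: `[cusp] − [box] = ([quartic] − [box]) − ([quartic] − [cusp])`,
two rational moves. In every TAME sub-calculus (bounded pieces, rule-2 maps extending to `C²` diffeomorphisms of a
neighbourhood of the closure — Richter's affine dissections, Cresson–Viu-Sos's `K₀(𝒞_saq)`) the parity of
singular boundary half-branches separates them; KZ's rule 2 is not tame, and any proof of the crux must use
boundary-singular moves like `cuspMap`. [folklore] -/
theorem cusp_sub_cuspBox_mem_planarGroup : KZ.of cuspRep - KZ.of cuspBox ∈ planarGroup := by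
  have h1 : KZ.of quarticRep - KZ.of cuspBox ∈ planarGroup :=
    mem_planarGroup_of_mem_changeOfVariablesRel (fun _ _ => rfl) (fun _ _ => rfl)
      quartic_sub_cuspBox_mem_changeOfVariablesRel
  have h2 : KZ.of quarticRep - KZ.of cuspRep ∈ planarGroup :=
    mem_planarGroup_of_mem_changeOfVariablesRel (fun _ _ => rfl) (fun _ _ => rfl)
      quartic_sub_cusp_mem_changeOfVariablesRel
  have := planarGroup.sub_mem h1 h2
  convert this using 1
  abel

/-- The two areas agree (`2/5`), as soundness of the planar group demands. [folklore] -/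
theorem value_cuspRep : cuspRep.value = 2 / 5 := by
  have h0 := eval_eq_zero_of_mem_planarGroup cusp_sub_cuspBox_mem_planarGroup
  rw [map_sub, KZ.eval_of, KZ.eval_of, sub_eq_zero] at h0
  rw [h0, value_boxRep (fun i => by fin_cases i <;> norm_num)]
  norm_num


/-! ## §11 Restrictions of planar sets and the a.e.-class lemma -/

/-- A planar set (integrand `1` on its domain) has finite area. [folklore] -/
theorem volume_domain_lt_top (r : KZ.IntegralRep 2) (hr : ∀ p ∈ r.domain, r.integrand p = 1) :
    volume r.domain < ⊤ := by
  have h1 : IntegrableOn (fun _ => (1 : ℝ)) r.domain :=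
    r.integrableOn.congr_fun (fun p hp => hr p hp) (KZ.IntegralRep.measurableSet_domain_holds r)
  rcases (integrableOn_const_iff (C := (1 : ℝ))).mp h1 with h | h
  · simp at h
  · exact h

/-- The restriction of a planar set to a ℚ-semialgebraic set `s`: domain `r.domain ∩ s`, integrand `1`.
[folklore] -/
def restrictRep (r : KZ.IntegralRep 2) (hr : ∀ p ∈ r.domain, r.integrand p = 1)
    (s : Set (Fin 2 → ℝ)) (hs : IsSemialgebraic ℚ s) : KZ.IntegralRep 2 where
  domain := r.domain ∩ s
  integrand := fun _ => 1
  isSemialgebraic_domain := r.isSemialgebraic_domain.inter hs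
  isSemialgebraicFunOn_integrand := isSemialgebraicFunOn_one (r.isSemialgebraic_domain.inter hs)
  integrableOn := integrableOn_const
    ((measure_mono inter_subset_left).trans_lt (volume_domain_lt_top r hr)).ne

/-- Unfolding. [folklore] -/
@[simp] theorem restrictRep_domain (r : KZ.IntegralRep 2) (hr : ∀ p ∈ r.domain, r.integrand p = 1)
    (s : Set (Fin 2 → ℝ)) (hs : IsSemialgebraic ℚ s) : (restrictRep r hr s hs).domain = r.domain ∩ s := rfl

/-- Unfolding. [folklore] -/
@[simp] theorem restrictRep_integrand (r : KZ.IntegralRep 2) (hr : ∀ p ∈ r.domain, r.integrand p = 1)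
    (s : Set (Fin 2 → ℝ)) (hs : IsSemialgebraic ℚ s) : (restrictRep r hr s hs).integrand = fun _ => 1 := rfl

/-- **CUTTING A PLANAR SET ALONG A SEMIALGEBRAIC SET (rule 1a inside the planar group).**
`[r] − [r ∩ s] − [r ∖ s] ∈ planarGroup` for every ℚ-semialgebraic `s` (disjoint pieces, empty overlap).
[folklore] -/
theorem of_sub_restrict_sub_restrict_compl_mem_planarGroup (r : KZ.IntegralRep 2)
    (hr : ∀ p ∈ r.domain, r.integrand p = 1) (s : Set (Fin 2 → ℝ)) (hs : IsSemialgebraic ℚ s) :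
    KZ.of r - KZ.of (restrictRep r hr s hs) - KZ.of (restrictRep r hr sᶜ hs.compl) ∈ planarGroup := by
  refine AddSubgroup.subset_closure ⟨Or.inl ?_, ?_⟩
  · refine ⟨2, r, restrictRep r hr s hs, restrictRep r hr sᶜ hs.compl, ?_, ?_, ?_, ?_, rfl⟩
    · simp [inter_union_compl]
    · have : r.domain ∩ s ∩ (r.domain ∩ sᶜ) = ∅ := by
        ext p; simp; tauto
      simp [this]
    · intro p hp
      simp only [restrictRep_domain] at hp
      simp [hr p hp.1]
    · intro p hp
      simp only [restrictRep_domain] at hp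
      simp [hr p hp.1]
  · refine (AddSubgroup.closure planarGens).sub_mem ((AddSubgroup.closure planarGens).sub_mem
      (AddSubgroup.subset_closure ⟨r, hr, rfl⟩) (AddSubgroup.subset_closure ⟨_, fun _ _ => rfl, rfl⟩))
      (AddSubgroup.subset_closure ⟨_, fun _ _ => rfl, rfl⟩)

/-- Hence, modulo the planar group, a planar set equals its restriction to any ℚ-semialgebraic set off
which it is null: `[r] − [r ∩ s] ∈ planarGroup` when `volume (r ∖ s) = 0`. [folklore] -/
theorem of_sub_restrict_mem_planarGroup (r : KZ.IntegralRep 2) (hr : ∀ p ∈ r.domain, r.integrand p = 1)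
    (s : Set (Fin 2 → ℝ)) (hs : IsSemialgebraic ℚ s) (h0 : volume (r.domain \ s) = 0) :
    KZ.of r - KZ.of (restrictRep r hr s hs) ∈ planarGroup := by
  have h1 := of_sub_restrict_sub_restrict_compl_mem_planarGroup r hr s hs
  have h2 : KZ.of (restrictRep r hr sᶜ hs.compl) ∈ planarGroup :=
    of_mem_planarGroup_of_volume_eq_zero _ (fun _ _ => rfl) (by simpa [sdiff_eq] using h0)
  have := planarGroup.add_mem h1 h2
  simpa using this

/-- **THE PLANAR SET-CHAIN GROUP ONLY SEES LEBESGUE CLASSES.** Two planar sets whose domains differ by a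
null set (`volume (D ∖ D') = 0 = volume (D' ∖ D)`) are congruent in the planar set-chain group: cut both
down to `D ∩ D'` (rule 1a, the differences being null planar sets, hence `0`), and relate the two
presentations of `D ∩ D'` by the identity move. So every invariant of the crux's calculus is a function
of the Lebesgue class of the domain; boundaries, hair and isolated points carry nothing. [folklore] -/
theorem of_sub_of_mem_planarGroup_of_ae_eq (r r' : KZ.IntegralRep 2)
    (hr : ∀ p ∈ r.domain, r.integrand p = 1) (hr' : ∀ p ∈ r'.domain, r'.integrand p = 1)
    (h₁ : volume (r.domain \ r'.domain) = 0) (h₂ : volume (r'.domain \ r.domain) = 0) :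
    KZ.of r - KZ.of r' ∈ planarGroup := by
  have a := of_sub_restrict_mem_planarGroup r hr r'.domain r'.isSemialgebraic_domain h₁
  have b := of_sub_restrict_mem_planarGroup r' hr' r.domain r.isSemialgebraic_domain h₂
  have c : KZ.of (restrictRep r hr r'.domain r'.isSemialgebraic_domain) -
      KZ.of (restrictRep r' hr' r.domain r.isSemialgebraic_domain) ∈ planarGroup :=
    of_sub_of_mem_planarGroup_of_domain_eq _ _ (fun _ _ => rfl) (fun _ _ => rfl)
      (by simp [inter_comm])
  have := planarGroup.sub_mem (planarGroup.add_mem a c) b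
  convert this using 1
  abel

/-- **COROLLARY (Dehn form).** Every additive invariant vanishing on the planar set-chain group takes
equal values on a.e.-equal planar sets; with `Negative/DehnForm.lean` this says a refuting invariant
lives on the measure algebra of ℚ-semialgebraic planar sets modulo null sets. [folklore] -/
theorem invariant_eq_of_ae_eq {A : Type*} [AddCommGroup A] (h : KZ.FormalRep →+ A)
    (hh : planarGroup ≤ h.ker) (r r' : KZ.IntegralRep 2)
    (hr : ∀ p ∈ r.domain, r.integrand p = 1) (hr' : ∀ p ∈ r'.domain, r'.integrand p = 1)
    (h₁ : volume (r.domain \ r'.domain) = 0) (h₂ : volume (r'.domain \ r.domain) = 0) :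
    h (KZ.of r) = h (KZ.of r') := by
  have h0 := hh (of_sub_of_mem_planarGroup_of_ae_eq r r' hr hr' h₁ h₂)
  rwa [AddMonoidHom.mem_ker, map_sub, sub_eq_zero] at h0

/-- Example of use: the closed and the open unit square (they differ by the null boundary) are
congruent — a second proof of the two-instance chain behind `not_planarOneMove`'s remark. [folklore] -/
theorem closedUnitSquare_sub_openUnitSquare_mem_planarGroup :
    KZ.of closedUnitSquare - KZ.of openUnitSquare ∈ planarGroup := by
  have hsub : openUnitSquare.domain ⊆ closedUnitSquare.domain := box_subset_Icc _ _
  refine of_sub_of_mem_planarGroup_of_ae_eq _ _ (fun _ _ => rfl) (fun _ _ => rfl) ?_ ?_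
  · have hO : volume openUnitSquare.domain = volume closedUnitSquare.domain := by
      simp only [boxRep_domain, closedBoxRep_domain, box]
      rw [Real.volume_pi_Ioo, Real.volume_Icc_pi]
    rw [measure_sdiff hsub (KZ.IntegralRep.measurableSet_domain_holds _).nullMeasurableSet
      (volume_box_ne_top _ _), hO, tsub_self]
  · have : openUnitSquare.domain \ closedUnitSquare.domain = ∅ := sdiff_eq_empty.mpr hsub
    rw [this, measure_empty]



/-! ## §12 Why the crux resists, cycle 3: the literature sweep and the TAME/NON-TAME dichotomy (prose) -/

/-- WHY IT RESISTS, cycle 3 (gen-3 disprover, 2026-08-16; paper analyses + the formal §10–§11). The print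
sweep that cycle 2 could not run (searchd rc 75) was done (zbMATH / Crossref / Springer OA; OpenAlex and S2
rate-limited, local FTS down — queries: "scissor congruence", "congruence by dissection topological discs
affine", "Tarski circle squaring", "Hilbert third problem curved", CVS arXiv:1912.01751 re-read). Findings:

(1) THE PRINTED THEORY OF CURVED DISSECTIONS IS A THEORY OF BOUNDARY ARCS, AND BOTH OF ITS ENGINES ARE
DISABLED BY KZ's RULE 2. Richter, *Congruence by dissection of topological discs*, Discrete Comput. Geom. 28
(2002) 427–442 (doi:10.1007/s00454-002-0748-5; continuing Dubins–Hirsch–Karush 1963): for a GROUP `G` of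
homeomorphisms of `ℝ²` and dissections into topological discs, Thm 1 (p. 430): if `E⁺, E⁻` are
`(G,𝓕)`-congruent by dissection then the `(G,𝓕)`-ESSENTIAL arcs of `bd E⁺ ∪ bd E⁻` (arcs of which no piece
boundary contains infinitely many disjoint `G`-copies) are permuted by maps of `G`; Lemma 5 (p. 433): for the
equiaffine group `Aff₁` an arc is essential iff it is not a segment (an equiaffine map cannot shrink a
curved arc below `√(area of an inscribed triangle)`); Thm 2(a) (p. 434): for `Isom⁺ ⊆ G ⊆ Aff₁`, two CONVEX
discs are `(G,𝒟⁰)`-congruent by dissection iff they have equal area AND their boundaries are piecewise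
`G`-congruent after removing finitely many segments; Cor. 2 (p. 436, affine isoperimetric inequality for the
equiaffine arclength `∫|det(ẋ,ẍ)|^{1/3}`): a disc and a square of equal area are NOT equiaffinely congruent by
dissection. This is the printed form of cycle 2's claim (5) "affine is not enough". Richter §5 (Lemma 6,
Prop. 2, p. 440–442): for the FULL affine group and pieces with piecewise-`C²` boundary, the parity
`μ(D) ∈ ℤ/2` of the number of one-sided boundary arc-ends with non-zero curvature is additive and
`Aff`-invariant; `μ(square) = 0 ≠ 1 = μ(conv{(ξ,ξ³)})`. In the crux's pseudogroup BOTH engines fail, for two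
independent reasons: (a) ESSENTIALITY fails — the shear `(x,y) ↦ (x, y − f(x))` straightens every Nash arc
`y = f(x)` and `diag(2^{-i}, 2^{i})` then hides infinitely many disjoint copies in one edge of a square, so
`𝓐_ess = ∅` and Thm 1 is void (equivalently: Thm 2(a)'s boundary condition "piecewise congruent after removing
segments" is vacuous for us since every arc is congruent to a segment); (b) TAMENESS fails — Richter's maps are
global homeomorphisms and Cresson–Viu-Sos's `K₀(𝒞_saq)` (arXiv:1912.01751 §2.2: `f : U → V` an algebraic
diffeomorphism of OPEN NEIGHBOURHOODS of the compact piece `K ⊂ U`, `det Jac f = 1`) uses maps smooth across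
the boundary of the piece, whereas `KZ.changeOfVariablesRel` asks differentiability WITHIN `r.domain` only: on
an open piece the map may blow up at the boundary (§8 `(1/x, x²y)`, §10 `(t², y/(2t))`, the cell-flattening
`(F(x), y/f(x))` at zeros/poles of `f`).

(2) THE TAME SUB-CALCULUS IS PROVABLY NOT AREA-COMPLETE (paper theorem, Richter's parity transplanted). Call a
rule-2 instance TAME if the piece is BOUNDED and `Φ` is the restriction of a `C²` diffeomorphism `Φ̃ : U → V`
of open sets with `U ⊇ D*`, the (then compact) essential closure `D* = {p : every neighbourhood of p meets
r.domain in positive measure}` (for semialgebraic `D`, `D* = cl(int-part)`, regular closed, `∂D*` a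
semialgebraic curve; Richter's discs and CVS's pieces `K` are compact — the boundedness clause is NEEDED: the
involution `(x,y) ↦ (1/x, x²y)`, a Nash diffeomorphism of `{x>0}×ℝ ⊇ E*`, carries the unbounded horn
`E = {u>1, 0<v<u^{-7/2}}` (all finite boundary half-branches smooth, `μ = 0`) onto the cusp cell `C` below
(`μ = 1`): singular half-branches can come in from infinity). For a regular closed
semialgebraic `K` put `μ(K) := Σ_{p ∈ ∂K} Σ_{β} φ(β) ∈ ℤ/2`, the inner sum over the one-sided half-branches `β`
of the curve germ `(∂K, p)` and `φ(β) = 1` iff the curvature of `β` is unbounded near `p` (equivalently for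
analytic half-branches: `β` is not the restriction of a smooth analytic arc through `p`, e.g. the Puiseux
half-branch `y = x^{3/2}`); only singular points of `∂K` contribute, so the sum is finite. CLAIMS: (i) `μ` is
additive under rule 1a: if `D = D₁ ∪ D₂` with null overlap then `D* = D₁* ∪ D₂*` with DISJOINT interiors
(two disjoint open semialgebraic sets cannot both be dense in a ball), every half-branch of `∂D*` at `p` is a
half-branch of exactly one `∂Dᵢ*`, and every internal half-branch (on `∂D₁* ∩ ∂D₂*`, off `∂D*`) is counted
twice — Richter's Lemma 6 argument verbatim, mod 2; (ii) `μ` kills null sets (`D* = ∅`); (iii) `μ` is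
invariant under tame moves (`D*` compact ⇒ `Φ̃(D*)` is compact, hence closed in `ℝ²`, and equals `(ΦD)*`;
half-branches go to half-branches, and a `C²` diffeomorphism preserves boundedness/unboundedness of the curvature
of an arc — its inverse is `C²` too); unbounded pieces admit no tame move at all, only cuts, and (i)–(ii) are local; (iv) `μ(C*) = 1` for the semicubical cusp cell
`C = {0<x<1, 0<y, y²<x³}` (at the origin: the segment half-branch, `φ = 0`, and `y = x^{3/2}`, `φ = 1`; the
corners `(1,0)`, `(1,1)` are smooth-smooth) and `μ(box) = 0`. HENCE: in the planar calculus with rule 2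
restricted to tame instances, `[C] − [(0,1)×(0,2/5)] ∉` the tame set-chain group although the areas agree
(`2/5`): "PlanarK0InjectiveTame" is FALSE. By contrast §10 (`cusp_sub_cuspBox_mem_planarGroup`, formal,
sorry-free) shows `[C] − [box] ∈ planarGroup` by the two rational NON-tame moves `(t², y/(2t))` (quartic cell
`{0<y<2t⁴}` → `C`, blowing the origin up into the cusp; note `μ(quartic cell) = 0`, so this move MUST be
non-tame, as it is) and `(t⁵, y/(5t⁴))` (quartic cell → box). CONSEQUENCES. (α) Boundary-singular moves are
LOAD-BEARING for the crux (information for the lead: `stub_cellReading`'s desingularisation/compactification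
maps are not cosmetic; no proof can stay inside tame moves). (β) The planar, product-free sector of
Cresson–Viu-Sos's `K₀(𝒞_saq)` has an invariant finer than area (their Remark 2.3 asks for "a similar
invariant [to Dehn's]"): `vol : K₀(𝒞_saq) → P` restricted to that sector is NOT injective, and this says
NOTHING about the period conjecture, precisely because KZ's own rule 2 is not tame. Whether `μ` survives their
product/flattening relations (all dimensions) I leave open. (γ) For the crux itself `μ` and every other
boundary-germ invariant (corner types, contact orders, Puiseux data, Richter's `κ = 0` parity, DHK/Hadwiger–Glur
arc classes, equiaffine length, ends at infinity) is DEAD: a refuting invariant must be a function of the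
Lebesgue class (§11, formal: `of_sub_of_mem_planarGroup_of_ae_eq`, `invariant_eq_of_ae_eq`) that is moreover
blind to boundary blow-ups/downs by maps Nash on the open piece — i.e. it can only read the PERIOD CONTENT of
the pieces (the classes of their CAD bands `{f<y<g}` ↦ `[cell of g−f]`, and a cell with semialgebraic
primitive is a box). This closes the circle with cycles 1–2: the only conceivable kill is a non-realisable
motivic relation among real 1-periods (Huber–Wüstholz Thm 13.3), i.e. a failure of `PlanarCompiler`, and no
mechanism for proving non-realisability other than an invariant of the above (non-existent) kind is known.

(3) THE HIERARCHY OF SUB-PSEUDOGROUPS AND THEIR DEHN INVARIANTS (each killed by the next move class; all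
paper, with the printed source where one exists): translations `ℚ²` + curved cuts — Hadwiger–Glur functionals
`J_u(D)` = signed length of the boundary SEGMENTS of `D*` orthogonal to `u` (curved arcs contribute `0`, cuts
cancel): triangle `≠` box; killed by shears/point reflections. Isometries — DHK 1963 / Richter Thm 2: all arcs
essential, disc `≠` square; killed by `diag(s,1/s)`. Equiaffine `Aff₁(ℚ̄∩ℝ)` + curved cuts — Richter Thm 2(a),
Cor. 2 (equiaffine arclength, signed by convexity: additive, so valid for the group form too), and beyond conics
the affine classes of higher-degree arcs (affine maps preserve the affine type of the Zariski closure of an arc):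
in dissection form, by Thm 1 + Lemma 5(b) the cubic arc of `D = {0<x<1, 0<y<x³+1}` is essential and could only be
matched inside its own orbit under the two-element equiaffine stabiliser of the cubic (identity: same side,
violating (iic); the point reflection about the inflexion: leaves the arc), so `D` is not equiaffinely congruent
by dissection to a box (a signed additive version weights affine-cubic arcs by projected length); killed by the
first non-affine shear `(x, y − x³)`. Tame Nash symplectic maps — the half-branch parity `μ` of
(2): cusp `≠` box; killed by boundary blow-ups. Full KZ rule 2 (the crux) — nothing known; area may be complete.
Informally: every time the move class becomes transitive on a germ type (arc germs: shears; corner germs: cuts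
through corners; singular half-branches: blow-ups), the corresponding local invariant dies, and KZ's class is
transitive on everything local. What is left is global and arithmetic.

(4) SMALL PRINT FOR PROVERS. `of_sub_restrict_sub_restrict_compl_mem_planarGroup` (§11) is the general "cut
along any ℚ-semialgebraic set" instance of rule 1a inside `planarGroup` (empty overlap), and
`of_sub_restrict_mem_planarGroup` discards any null part; together with `Kit` §1 they give the complete
null-set bookkeeping `stub_cellReading` needs. `mem_planarGroup_of_mem_changeOfVariablesRel` (§10) packages
"a rule-2 instance between planar sets is a planar move".

LITERATURE NOT OBTAINED: Richter, *Affine congruence by dissection of discs — appropriate groups and optimal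
dissections*, J. Geom. 84 (2005) (doi:10.1007/s00022-005-0025-x; acq-03542, paywalled) — by its zbMATH title it
classifies which groups between `Aff₁` and `Aff` square the circle; it cannot bear on the crux (all those groups
are tame and affine) but would complete row "equiaffine" of (3). Hertel–Richter, *Squaring the circle by
dissection*, Beitr. Algebra Geom. 44 (2003) 47–55 (full affine group; area not preserved; irrelevant to the
crux except as the source of Richter's Table 1). [folklore] -/
def whyItResists3 : Prop := True

end Summit.KontsevichZagierPeriods.KontsevichZagierPeriods.Cruxes.PlanarK0Injective.Disproof
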